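import Literature.Computability.QuantumComplexity.QuadraticBooleanWalsh
import Mathlib.Algebra.Order.BigOperators.Ring.Finset
import Mathlib.Algebra.BigOperators.Field
import Mathlib.RingTheory.RootsOfUnity.Complex
import Mathlib.Data.Real.Basic
import Mathlib.Tactic.Linarith
import Mathlib.Tactic.Positivity
import Mathlib.Tactic.FieldSimp
import Mathlib.Tactic.Ring
import HarnessLib

/-!
# Anticoncentration of IQP amplitudes over random degree-3 polynomials (Bremner–Montanaro–Shepherd 2016)

Topic `Literature/Computability/QuantumComplexity` (pub-qadeq lane, CLAIMS §5: the hardness language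
of the IQP / random-circuit sampling rows E-01…E-10, E-16 — “anticoncentration” is the property an
average-case hardness argument à la Bremner–Montanaro–Shepherd needs of the circuit family, and for
the degree-3 family `{Z, CZ, CCZ}` conjugated by Hadamards it is a THEOREM, proved here; companion
of `QuadraticBooleanWalsh.lean` (the quadratic = Clifford slice) and of `PauliPathOrthogonality.lean`,
whose truncation bound is proved modulo an anticoncentration ASSUMPTION on the ensemble).

HONEST FRAMING: instance-level adjudication of specific advantage claims; no claim about BQP vs BPP
or the summit.  This file proves finite identities and inequalities about sums of `±1`; it asserts
nothing about any device, any noise model, or the truth of the paper's Conjectures 2–3.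

## Source statements formalised [cite: BremnerMontanaroShepherd2016]

M. J. Bremner, A. Montanaro, D. J. Shepherd, *Average-case complexity versus approximate simulation
of commuting quantum computations*, Phys. Rev. Lett. **117**, 080501 (2016) = arXiv:1504.07999
(held text `paper:arxiv-1504.07999`, read by the seat 2026-08-22):

* p. 3: “the gap of degree-3 polynomials over 𝔽₂, f : {0,1}ⁿ → {0,1}, which are expressible (up to
  an additive constant) as f(x) = Σ_{i,j,k} α_{ijk} x_i x_j x_k + Σ_{i,j} β_{ij} x_i x_j + Σ_i γ_i x_i
  (mod 2) … The gap is defined by gap(f) := |{x : f(x) = 0}| − |{x : f(x) = 1}| … for any degree-3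
  polynomial f, ⟨0|^{⊗n} 𝒞_f |0⟩^{⊗n} = gap(f)/2ⁿ for IQP circuits 𝒞_f whose diagonal component is
  constructed from Z, CZ, and CCZ gates … We write ngap(f) = gap(f)/2ⁿ.”
* Appendix ‘Gaps of degree-3 polynomials’: “⟨0|^{⊗n} H^{⊗n} 𝒞̃_f H^{⊗n}|0⟩^{⊗n}
  = 2^{−n} Σ_{x,y} ⟨y|𝒞̃_f|x⟩ = 2^{−n} Σ_x (−1)^{f(x)} = 2^{−n} gap(f)”.
* p. 5, Fact 5 (Paley–Zygmund inequality): “If R is a non-negative random variable with finite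
  variance, then for any 0 < α < 1, Pr[R ≥ α 𝔼[R]] ≥ (1 − α)² 𝔼[R]²/𝔼[R²].”
* p. 5: “𝔼_𝒞[|⟨0|𝒞|0⟩|²] = 𝔼_{𝒟,x}[|⟨x|𝒟|0⟩|²] = 2^{−n} 𝔼_𝒟 Σ_x |⟨x|𝒟|0⟩|² = 2^{−n}” (“appending X
  gates on a uniformly random subset S of the qubits”; App.: “the random γ_i coefficients correspond
  to applying X gates to a random subset of the qubits”).
* Appendix ‘Proofs of anticoncentration bounds’, Lemma 11 (here in its `r = s = 2` case, the one
  used for 𝒞_f): “Σ_{w,x,y,z ∈ {0,1}ⁿ} |𝔼_α[ω^{Σ_{i<j} α_{ij}(w_iw_j + x_ix_j − y_iy_j − z_iz_j)}]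
  𝔼_β[η^{Σ_k β_k(w_k + x_k − y_k − z_k)}]| ≤ 3 · 2^{2n}”, with its proof: the second factor “equals 0
  unless z ≡ w + x − y”, and then the first vanishes unless “w = x, w = y or x = y”.
* Lemma 12: “Let f : {0,1}ⁿ → {0,1} be a polynomial over 𝔽₂ whose degree ≤ 2 part is uniformly
  random. Then 𝔼_f[ngap(f)⁴] ≤ 3 · 2^{−2n}”, proof: “𝔼_f[ngap(f)⁴] = (1/2^{4n}) Σ_{w,x,y,z} 𝔼_f[(−1)^
  {f(w)+f(x)+f(y)+f(z)}]” and the degree `> 2` part contributes a sign only.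
* Theorem 6, proof: “Combining Fact 5 and the bound on 𝔼_f[ngap(f)⁴], we have
  Pr_f[ngap(f)² ≥ α/2ⁿ] ≥ (1 − α)²/3 for any 0 < α < 1. Fixing α = 1/2, we get
  Pr_f[ngap(f)² ≥ 2^{−n−1}] ≥ 1/12.”

## Contents (all proved; 0 named facts)

Vectors are `x : V → ZMod 2` (`|V| = n`), signs `chi a = (−1)^a` and `signSum f = Σ_x (−1)^{f x}`
(`= gap(f)`) come from `GraphStateCutRank.lean` / `QuadraticBooleanWalsh.lean`.

* `signSum_eq_card_sub_card` (`gap(f) = |{f = 0}| − |{f = 1}|` as printed), `ngap f = gap(f)/2ⁿ`.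
* `walshHadamard` (`W(x,y) = (−1)^{x·y}`, so `H^{⊗n} = W/2^{n/2}`), `walshHadamard_mul_self`
  (`W² = 2ⁿ·1`), `phaseDiag f` (`𝒞̃_f`), **`walshHadamard_phase_walshHadamard_zero_zero`**
  (`(W·𝒞̃_f·W)(0ⁿ,0ⁿ) = gap(f)`), hence `⟨0|H^{⊗n} 𝒞̃_f H^{⊗n}|0⟩ = ngap(f)`
  (`hdh_zero_zero_eq_ngap`).
* The random family: `quadPart β γ x = Σ_{i,j} β_{ij} x_i x_j + Σ_k γ_k x_k` (coefficients
  `β : V → V → ZMod 2` over ALL ordered pairs and `γ : V → ZMod 2`, uniformly random;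
  `quadPart_eq_quadForm` links it to the tree's `quadForm`), `poly h β γ = h + quadPart β γ` for an
  ARBITRARY fixed `h` (the degree `> 2` part — for BMS the cubic form, `cubicPart`).  The paper's
  `Σ_{i<j}` indexing differs only by duplicated independent coins: `(β, γ) ↦ quadPart β γ` is a
  linear surjection of `𝔽₂^{n²+n}` onto the degree-`≤ 2` polynomial functions vanishing at `0ⁿ`
  (coefficient of `x_ix_j`, `i < j`, is `β_{ij} + β_{ji}`; of `x_i` is `β_{ii} + γ_i`), so the
  uniform law on `(β, γ)` induces exactly “degree `≤ 2` part uniformly random”, and each summand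
  of Lemma 11 takes the same value as printed.
* **`paleyZygmund_card`**, **`paleyZygmund_avg`** (Fact 5 for the uniform distribution on a finite
  sample space, via Cauchy–Schwarz; the measure-theoretic form is the tree's
  `Literature.Probability.Moments.paleyZygmund`).
* **`sum_signSum_addLinear_sq`**: `Σ_γ gap(g + γ·x)² = 2ⁿ·2ⁿ`, i.e. `𝔼_γ[ngap²] = 2^{−n}` for every `g`
  (`sum_sum_ngap_poly_sq`: `Σ_{β,γ} ngap² = 2^{n²}`).
* `Pairing w x y z` (`(w = x ∧ y = z) ∨ (w = y ∧ x = z) ∨ (w = z ∧ x = y)`),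
  **`pairing_of_constraints`** (the heart of Lemma 11: `w + x + y + z = 0` and
  `∀ i j, w_iw_j + x_ix_j + y_iy_j + z_iz_j = 0` force a pairing) and its converse,
  `pairingCount_le` (`#pairings ≤ 3·(2ⁿ)²`).
* **`sum_sum_signSum_poly_pow_four`** (`Σ_{β,γ} gap(poly h β γ)⁴ = 2^{n²}·2ⁿ·#pairings`),
  **`lemma11_two`** (Lemma 11, `r = s = 2`), **`avg_ngap_pow_four_le`** (Lemma 12:
  `𝔼_{β,γ}[ngap⁴] ≤ 3·2^{−2n}`).
* **`prob_ngap_sq_ge`** (Theorem 6's anticoncentration sentence: `(1 − α)²/3 ≤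
  Pr_{β,γ}[ngap² ≥ α/2ⁿ]` for `0 ≤ α < 1`), **`twelfth_le_prob_ngap_sq_ge`** (`α = 1/2`:
  `1/12 ≤ Pr[ngap² ≥ 2^{−n−1}]`), and `twelfth_le_prob_ngap_sq_ge_cubic` (the same with the cubic
  coefficients `α_{ijk}` also uniformly random — “a uniformly random degree-3 polynomial”).
* (v2, section `GeneralRoots`) **Lemma 11 AS PRINTED**, for `ω, η` primitive `r`-th / `s`-th
  roots of unity (`r, s ≥ 2`, `s = 2 → r = 2`), coins `α_{ij}` uniform on `{0,…,r−1}` for `i < j`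
  and `β_k` uniform on `{0,…,s−1}`: `sum_rootChar` (`Σ_{a<r} ω^{at} = r·[r ∣ t]`),
  `sum_zpow_sum_eq_prod` (independence of the coins), **`pairing_of_root_constraints`** (the
  printed case analysis over `ℤ`: `s ∣ w_k + x_k − y_k − z_k ∀k` and
  `r ∣ w_iw_j + x_ix_j − y_iy_j − z_iz_j ∀ i<j` force a pairing), **`lemma11`**
  (`Σ_{w,x,y,z} ‖𝔼_α[ω^{Σ_{i<j} α_{ij}(…)}] 𝔼_β[η^{Σ_k β_k(…)}]‖ ≤ 3·2^{2n}`) and `lemma11_exp`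
  (`ω = e^{2πi/r}`, `η = e^{2πi/s}`).
* (v3, section `IsingFamily`) **the random Ising family `𝒞_I`**: `isingZ ω w v =
  Σ_{z∈{±1}ⁿ} ω^{Σ_{i<j} w_{ij}z_iz_j + Σ_k v_kz_k}` (eq. (1); `spin`, `isingExp`), the App.
  rewriting `isingExp_eq` (`= (Σw + Σv) + 4Σ w_{ij}x_ix_j + 2Σ v'_kx_k`, `v'_k = −v_k − Σ_{j≠k} w_{jk}`:
  `pairShift`, `vPrime`), `norm_isingZ_eq` (“up to an easily computed phase”),
  `sum_rootChar_of_dvd` / `sum_zpow_sum_eq_of_dvd` (coins on `{0,…,7}` seen by `i = ω⁴`, `ω²`), and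
  **`avg_norm_isingZ_pow_four_le`**: `𝔼_{w,v}[|Z(ω)|⁴] ≤ 3·2^{2n}` for any primitive 16-th root `ω`
  (`avg_norm_isingZ_pow_four_le_exp` for `ω = e^{iπ/8}`), via Lemma 11 with `r = 4`, `s = 8`.
* Section `OutputDistribution` (v4): `walshHadamard_phase_walshHadamard_apply_zero`
  (`(W 𝒞̃_f W)(x, 0ⁿ) = gap(f_x)`, `f_x(y) = f(y) + x·y` — “p_{0y} = |⟨y|𝒞_0|0⟩|² = |⟨0|𝒞_y|0⟩|²”:
  an output string only adds a linear form), `outputProb f x = ngap(f_x)²` with `outputProb_eq_hdh_sq`,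
  and Parseval **`sum_outputProb`**: `Σ_x p_f(x) = 1` (`avg_outputProb`: `𝔼_x[p_f(x)] = 2^{−n}`, the
  printed first-moment computation).
* NOT here: Stockmeyer counting / Theorem 1 / Corollary 9 / Theorems 6–7 themselves
  (complexity-class statements), the `{√CZ, T}` circuit reading of `𝒞_I` (“consisting of gates from
  the set {diag(1,1,1,i), diag(1,e^{iπ/4})}”), and Conjectures 2–3 (conjectures, not results).
-/

noncomputable section

open Matrix Finset

namespace Literature.Computability.QuantumComplexity

namespace IQPAnticoncentration

open GraphStateCutRank QuadraticBooleanWalsh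

variable {K : Type*} [Field K]
variable {V : Type*} [Fintype V] [DecidableEq V]

/-! ### `gap`, `ngap` and the `H–D–H` amplitude -/

/-- **The gap as printed**: `Σ_x (−1)^{f(x)} = |{x : f(x) = 0}| − |{x : f(x) = 1}|`.
[cite: BremnerMontanaroShepherd2016, p. 3 (“gap(f) := |{x: f(x)=0}| − |{x: f(x)=1}|”)] -/
theorem signSum_eq_card_sub_card (f : (V → ZMod 2) → ZMod 2) :
    (signSum f : K) = ((univ.filter fun x => f x = 0).card : K) -
      ((univ.filter fun x => f x = 1).card : K) := by
  unfold signSum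
  have h10 : (1 : ZMod 2) ≠ 0 := by decide
  have hsplit : ∀ x : V → ZMod 2, (chi (f x) : K) =
      (if f x = 0 then (1 : K) else 0) - (if f x = 1 then (1 : K) else 0) := by
    intro x
    have h01 : f x = 0 ∨ f x = 1 := by generalize f x = a; revert a; decide
    rcases h01 with h | h <;> rw [h]
    · simp [h10.symm]
    · rw [chi_of_ne_zero h10]
      simp [h10]
  simp_rw [hsplit]
  rw [sum_sub_distrib, sum_boole, sum_boole]

/-- `ngap(f) = gap(f)/2ⁿ`. [cite: BremnerMontanaroShepherd2016, p. 3 (“We write ngap(f) = gap(f)/2ⁿ”)] -/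
def ngap (f : (V → ZMod 2) → ZMod 2) : K := signSum f / (2 : K) ^ Fintype.card V

/-- `|𝔽₂^V| = 2ⁿ` (plumbing). [folklore] -/
private theorem card_strings : Fintype.card (V → ZMod 2) = 2 ^ Fintype.card V := by
  rw [Fintype.card_fun, ZMod.card]

/-- The unnormalised Walsh–Hadamard matrix `W(x, y) = (−1)^{x·y}` on `𝔽₂^V`
(`H^{⊗n} = 2^{−n/2} W`). [cite: BremnerMontanaroShepherd2016, App. ‘Gaps of degree-3 polynomials’ (“𝒞_f = H^{⊗n} 𝒞̃_f H^{⊗n}”)] -/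
def walshHadamard : Matrix (V → ZMod 2) (V → ZMod 2) K := fun x y => chi (x ⬝ᵥ y)

/-- `W² = 2ⁿ · 1`, i.e. `2^{−n/2} W` is an involutive unitary (this is what fixes the
normalisation `2^{−n}` of the amplitude). [cite: BremnerMontanaroShepherd2016, App. ‘Gaps of degree-3 polynomials’] -/
theorem walshHadamard_mul_self [NeZero (2 : K)] :
    (walshHadamard : Matrix (V → ZMod 2) (V → ZMod 2) K) * walshHadamard =
      ((2 : K) ^ Fintype.card V) • (1 : Matrix (V → ZMod 2) (V → ZMod 2) K) := by
  ext x z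
  rw [mul_apply, Matrix.smul_apply, one_apply]
  have : ∀ y : V → ZMod 2, (walshHadamard x y : K) * walshHadamard y z =
      chi (y ⬝ᵥ x) * chi (y ⬝ᵥ z) := by
    intro y
    simp only [walshHadamard, dotProduct_comm x y]
  simp_rw [this, sum_chi_mul_chi]
  split_ifs <;> simp

/-- The diagonal phase circuit `𝒞̃_f = diag((−1)^{f(x)})` (for a degree-3 `f`: the product of the
`Z`, `CZ`, `CCZ` gates of its monomials). [cite: BremnerMontanaroShepherd2016, App. ‘Gaps of degree-3 polynomials’ (“in order to generate the phase (−1)^{f(x)}|x⟩ …”)] -/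
def phaseDiag (f : (V → ZMod 2) → ZMod 2) : Matrix (V → ZMod 2) (V → ZMod 2) K :=
  diagonal fun x => chi (f x)

/-- **`(W · 𝒞̃_f · W)(0ⁿ, 0ⁿ) = Σ_x (−1)^{f(x)} = gap(f)`.**
[cite: BremnerMontanaroShepherd2016, App. ‘Gaps of degree-3 polynomials’ (“= 2^{−n} Σ_x (−1)^{f(x)} = 2^{−n} gap(f)”)] -/
theorem walshHadamard_phase_walshHadamard_zero_zero (f : (V → ZMod 2) → ZMod 2) :
    (walshHadamard * phaseDiag f * walshHadamard : Matrix (V → ZMod 2) (V → ZMod 2) K) 0 0 =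
      signSum f := by
  rw [mul_apply]
  unfold signSum
  refine sum_congr rfl fun x _ => ?_
  rw [phaseDiag, mul_diagonal]
  simp [walshHadamard]

/-- **The IQP amplitude is the normalised gap**: with `H^{⊗n} = 2^{−n/2} W`,
`⟨0ⁿ| H^{⊗n} 𝒞̃_f H^{⊗n} |0ⁿ⟩ = 2^{−n} (W 𝒞̃_f W)(0ⁿ,0ⁿ) = ngap(f)`.
[cite: BremnerMontanaroShepherd2016, p. 3 and App. ‘Gaps of degree-3 polynomials’] -/
theorem hdh_zero_zero_eq_ngap (f : (V → ZMod 2) → ZMod 2) :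
    (walshHadamard * phaseDiag f * walshHadamard : Matrix (V → ZMod 2) (V → ZMod 2) K) 0 0 /
        (2 : K) ^ Fintype.card V = ngap f := by
  rw [walshHadamard_phase_walshHadamard_zero_zero, ngap]

/-! ### The random family: uniformly random degree-`≤ 2` part -/

/-- The degree-`≤ 2` part with coefficients `β_{ij}`, `γ_k`:
`Σ_{i,j} β_{ij} x_i x_j + Σ_k γ_k x_k (mod 2)`.
[cite: BremnerMontanaroShepherd2016, App. Lemma 12 proof (“f_{≤2}(x) = Σ_{i,j} β_{ij} x_i x_j + Σ_k γ_k x_k”)] -/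
def quadPart (β : V → V → ZMod 2) (γ : V → ZMod 2) (x : V → ZMod 2) : ZMod 2 :=
  ∑ i, ∑ j, β i j * (x i * x j) + ∑ k, γ k * x k

omit [DecidableEq V] in
/-- `quadPart β γ` is the tree's quadratic form `x·(βx) + γ·x` of `QuadraticBooleanWalsh`
(so it is `IsQuadratic`, i.e. the Clifford slice). [cite: BremnerMontanaroShepherd2016, App. Lemma 12 proof] -/
theorem quadPart_eq_quadForm (β : V → V → ZMod 2) (γ : V → ZMod 2) (x : V → ZMod 2) :
    quadPart β γ x = quadForm (Matrix.of β) γ 0 x := by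
  unfold quadPart quadForm
  simp only [dotProduct, mulVec, Matrix.of_apply, add_zero, Finset.mul_sum]
  congr 1
  refine sum_congr rfl fun i _ => sum_congr rfl fun j _ => ?_
  ring

/-- A polynomial “whose degree `≤ 2` part is uniformly random”: a FIXED function `h` (for the
paper, the cubic part `Σ α_{ijk} x_ix_jx_k`; the proofs never use its shape) plus `quadPart β γ`.
[cite: BremnerMontanaroShepherd2016, App. Lemma 12 (“Let f_{≤2} and f_{>2} be the parts of f of degree ≤ 2 and degree > 2”)] -/
def poly (h : (V → ZMod 2) → ZMod 2) (β : V → V → ZMod 2) (γ : V → ZMod 2) :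
    (V → ZMod 2) → ZMod 2 :=
  fun x => h x + quadPart β γ x

/-- The cubic part `Σ_{i,j,k} α_{ijk} x_i x_j x_k` of a degree-3 polynomial.
[cite: BremnerMontanaroShepherd2016, p. 3 (display of f)] -/
def cubicPart (α : V → V → V → ZMod 2) (x : V → ZMod 2) : ZMod 2 :=
  ∑ i, ∑ j, ∑ k, α i j k * (x i * x j * x k)

omit [DecidableEq V] in
/-- `poly h β γ x = (h x + Σ β_{ij} x_ix_j) + γ·x`: the linear coefficients enter through the
character `γ·x` (“random X gates”). [cite: BremnerMontanaroShepherd2016, App. (“the random γ_i coefficients correspond to applying X gates to a random subset of the qubits”)] -/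
theorem poly_apply (h : (V → ZMod 2) → ZMod 2) (β : V → V → ZMod 2) (γ : V → ZMod 2)
    (x : V → ZMod 2) :
    poly h β γ x = (h x + ∑ i, ∑ j, β i j * (x i * x j)) + γ ⬝ᵥ x := by
  simp only [poly, quadPart, dotProduct, add_assoc]

/-! ### Fact 5: the Paley–Zygmund inequality for a uniform finite sample space -/

/-- **Paley–Zygmund, finite uniform form.**  For `R` on a finite sample space `Ω` (uniform
distribution) and a level `0 ≤ a` with `a·|Ω| ≤ Σ R` (i.e. `a ≤ 𝔼R`; for `a ≥ 0` the sign of `R`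
is immaterial):
`(Σ_ω R − a|Ω|)² ≤ (Σ_ω R²) · #{ω : a ≤ R ω}`, i.e. `Pr[R ≥ a] ≥ (𝔼R − a)²/𝔼[R²]`; with
`a = α 𝔼R` this is Fact 5.  (Cauchy–Schwarz on `𝔼[R; R ≥ a]`; the tree's measure-theoretic form
is `Literature.Probability.Moments.paleyZygmund`.)
[cite: BremnerMontanaroShepherd2016, Fact 5 (Paley–Zygmund inequality)] -/
theorem paleyZygmund_card {Ω : Type*} [Fintype Ω] (R : Ω → ℝ) {a : ℝ}
    (ha0 : 0 ≤ a) (ha : a * Fintype.card Ω ≤ ∑ ω, R ω) :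
    (∑ ω, R ω - a * Fintype.card Ω) ^ 2 ≤
      (∑ ω, R ω ^ 2) * ((univ.filter fun ω => a ≤ R ω).card : ℝ) := by
  classical
  set A := univ.filter fun ω : Ω => a ≤ R ω with hA
  -- `Σ R ≤ a |Ω| + Σ_{R ≥ a} R`
  have hsplit : ∑ ω, R ω ≤ a * Fintype.card Ω + ∑ ω ∈ A, R ω := by
    have h1 : ∑ ω, R ω = ∑ ω ∈ A, R ω + ∑ ω ∈ univ.filter (fun ω => ¬ a ≤ R ω), R ω :=
      (sum_filter_add_sum_filter_not univ (fun ω => a ≤ R ω) R).symm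
    have h2 : ∑ ω ∈ univ.filter (fun ω => ¬ a ≤ R ω), R ω ≤
        ∑ _ω ∈ univ.filter (fun ω => ¬ a ≤ R ω), a :=
      sum_le_sum fun ω hω => (lt_of_not_ge (mem_filter.1 hω).2).le
    have h3 : ∑ _ω ∈ univ.filter (fun ω => ¬ a ≤ R ω), a ≤ a * Fintype.card Ω := by
      rw [sum_const, nsmul_eq_mul, mul_comm]
      exact mul_le_mul_of_nonneg_left (by exact_mod_cast card_le_univ _) ha0
    linarith
  have hpos : 0 ≤ ∑ ω, R ω - a * Fintype.card Ω := by linarith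
  have hle : ∑ ω, R ω - a * Fintype.card Ω ≤ ∑ ω ∈ A, R ω := by linarith
  -- Cauchy–Schwarz: `(Σ_A R)² ≤ (Σ R²) · |A|`
  have hCS : (∑ ω ∈ A, R ω) ^ 2 ≤ (∑ ω, R ω ^ 2) * (A.card : ℝ) := by
    have h := sum_sq_le_sum_mul_sum_of_sq_le_mul (R := ℝ) univ
      (f := fun ω => R ω ^ 2) (g := fun ω => if ω ∈ A then (1 : ℝ) else 0)
      (r := fun ω => if ω ∈ A then R ω else 0)
      (fun ω _ => sq_nonneg _) (fun ω _ => by split_ifs <;> norm_num)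
      (fun ω _ => by split_ifs <;> simp)
    have hr : ∑ ω, (if ω ∈ A then R ω else 0) = ∑ ω ∈ A, R ω := by
      rw [← sum_filter]; congr 1; ext ω; simp
    have hg : ∑ ω, (if ω ∈ A then (1 : ℝ) else 0) = A.card := by
      rw [sum_boole]; congr 2; ext ω; simp
    rw [hr, hg] at h
    exact h
  calc (∑ ω, R ω - a * Fintype.card Ω) ^ 2 ≤ (∑ ω ∈ A, R ω) ^ 2 :=
        pow_le_pow_left₀ hpos hle 2
    _ ≤ (∑ ω, R ω ^ 2) * (A.card : ℝ) := hCS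

/-- **Fact 5 as printed** (uniform finite sample space): for `R ≥ 0` and `0 ≤ α < 1`,
`(1 − α)² (𝔼R)² ≤ 𝔼[R²] · Pr[R ≥ α 𝔼R]`, written with `𝔼R = (Σ R)/|Ω|`, `Pr[A] = #A/|Ω|`.
[cite: BremnerMontanaroShepherd2016, Fact 5 (Paley–Zygmund inequality)] -/
theorem paleyZygmund_avg {Ω : Type*} [Fintype Ω] [Nonempty Ω] (R : Ω → ℝ) (hR : ∀ ω, 0 ≤ R ω)
    {α : ℝ} (hα0 : 0 ≤ α) (hα : α < 1) :
    (1 - α) ^ 2 * ((∑ ω, R ω) / Fintype.card Ω) ^ 2 ≤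
      ((∑ ω, R ω ^ 2) / Fintype.card Ω) *
        (((univ.filter fun ω => α * ((∑ ω, R ω) / Fintype.card Ω) ≤ R ω).card : ℝ) /
          Fintype.card Ω) := by
  have hN : (0 : ℝ) < Fintype.card Ω := by exact_mod_cast Fintype.card_pos
  set μ := (∑ ω, R ω) / Fintype.card Ω with hμ
  have hsum : ∑ ω, R ω = μ * Fintype.card Ω := by rw [hμ]; field_simp
  have hμ0 : 0 ≤ μ := div_nonneg (sum_nonneg fun ω _ => hR ω) hN.le
  have ha : α * μ * Fintype.card Ω ≤ ∑ ω, R ω := by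
    rw [hsum]
    exact mul_le_mul_of_nonneg_right (mul_le_of_le_one_left hμ0 hα.le) hN.le
  have h := paleyZygmund_card R (mul_nonneg hα0 hμ0) ha
  rw [hsum] at h
  have h' : ((1 - α) * μ) ^ 2 * (Fintype.card Ω : ℝ) ^ 2 ≤
      (∑ ω, R ω ^ 2) * ((univ.filter fun ω => α * μ ≤ R ω).card : ℝ) := by
    have : μ * Fintype.card Ω - α * μ * Fintype.card Ω = (1 - α) * μ * Fintype.card Ω := by ring
    rw [this] at h
    nlinarith [h]
  rw [div_mul_div_comm, le_div_iff₀ (by positivity)]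
  nlinarith [h']

/-! ### First moment: `𝔼_γ[gap²] = 2ⁿ` -/

omit [Fintype V] [DecidableEq V] in
/-- In `𝔽₂^V`, `x + y = 0 ↔ y = x`. [folklore] -/
private theorem add_eq_zero_iff_eq_swap (x y : V → ZMod 2) : x + y = 0 ↔ y = x := by
  constructor
  · intro h
    funext v
    have := congr_fun h v
    simp only [Pi.add_apply, Pi.zero_apply] at this
    generalize x v = a, y v = b at this ⊢
    revert a b; decide
  · intro h
    rw [h]
    funext v
    simp only [Pi.add_apply, Pi.zero_apply]
    generalize x v = a; revert a; decide

/-- **`Σ_γ (Σ_x (−1)^{g(x) + γ·x})² = 2ⁿ · 2ⁿ`** for every `g` — the random linear part alone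
(random `X` gates) gives `𝔼[ngap²] = 2^{−n}` exactly.
[cite: BremnerMontanaroShepherd2016, p. 5 (“𝔼_𝒞[|⟨0|𝒞|0⟩|²] = … = 2^{−n}”)] -/
theorem sum_signSum_addLinear_sq [NeZero (2 : K)] (g : (V → ZMod 2) → ZMod 2) :
    ∑ γ : V → ZMod 2, (signSum (fun x => g x + γ ⬝ᵥ x) : K) ^ 2 =
      (2 : K) ^ Fintype.card V * (2 : K) ^ Fintype.card V := by
  unfold signSum
  have hexp : ∀ γ : V → ZMod 2, (∑ x : V → ZMod 2, (chi (g x + γ ⬝ᵥ x) : K)) ^ 2 =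
      ∑ x : V → ZMod 2, ∑ y : V → ZMod 2,
        (chi (g x) : K) * chi (g y) * chi (γ ⬝ᵥ (x + y)) := by
    intro γ
    rw [sq, sum_mul_sum]
    refine sum_congr rfl fun x _ => sum_congr rfl fun y _ => ?_
    rw [chi_add, chi_add, dotProduct_add, chi_add]
    ring
  have hγ : ∀ x y : V → ZMod 2, ∑ γ : V → ZMod 2, (chi (γ ⬝ᵥ (x + y)) : K) =
      if y = x then (2 : K) ^ Fintype.card V else 0 := by
    intro x y
    rw [sum_chi_dotProduct]
    exact if_congr (add_eq_zero_iff_eq_swap x y) rfl rfl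
  calc ∑ γ : V → ZMod 2, (∑ x : V → ZMod 2, (chi (g x + γ ⬝ᵥ x) : K)) ^ 2
      = ∑ γ : V → ZMod 2, ∑ x : V → ZMod 2, ∑ y : V → ZMod 2,
          (chi (g x) : K) * chi (g y) * chi (γ ⬝ᵥ (x + y)) := sum_congr rfl fun γ _ => hexp γ
    _ = ∑ x : V → ZMod 2, ∑ y : V → ZMod 2, ∑ γ : V → ZMod 2,
          (chi (g x) : K) * chi (g y) * chi (γ ⬝ᵥ (x + y)) := by
        rw [sum_comm]
        exact sum_congr rfl fun x _ => sum_comm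
    _ = ∑ x : V → ZMod 2, ∑ y : V → ZMod 2,
          (chi (g x) : K) * chi (g y) * (if y = x then (2 : K) ^ Fintype.card V else 0) := by
        refine sum_congr rfl fun x _ => sum_congr rfl fun y _ => ?_
        rw [← mul_sum, hγ]
    _ = ∑ x : V → ZMod 2, (chi (g x) : K) * chi (g x) * (2 : K) ^ Fintype.card V := by
        refine sum_congr rfl fun x _ => ?_
        simp_rw [mul_ite, mul_zero]
        rw [Finset.sum_ite_eq' univ x]
        simp
    _ = (2 : K) ^ Fintype.card V * (2 : K) ^ Fintype.card V := by
        simp_rw [chi_mul_self, one_mul, sum_const, card_univ, card_strings, nsmul_eq_mul]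
        push_cast
        ring

/-! ### Pairings (the combinatorial core of Lemma 11, case `r = s = 2`) -/

/-- The three pairings of a 4-tuple. [cite: BremnerMontanaroShepherd2016, App. Lemma 11 proof (“unless both z ≡ w + x − y … and also w = x, w = y or x = y”)] -/
def Pairing (w x y z : V → ZMod 2) : Prop := (w = x ∧ y = z) ∨ (w = y ∧ x = z) ∨ (w = z ∧ x = y)

/-- `Pairing` is decidable. [folklore] -/
instance instDecidablePairing (w x y z : V → ZMod 2) : Decidable (Pairing w x y z) := by
  unfold Pairing; infer_instance

omit [Fintype V] [DecidableEq V] in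
/-- Bit arithmetic: in `𝔽₂`, `u ≠ v ↔ u = v + 1`. [folklore] -/
private theorem ne_iff_eq_add_one (u v : ZMod 2) : u ≠ v ↔ u = v + 1 := by
  revert u v; decide

omit [Fintype V] [DecidableEq V] in
/-- **Lemma 11's case analysis (`r = s = 2`).**  If `w + x + y + z = 0` (the linear characters
survive) and `w_iw_j + x_ix_j + y_iy_j + z_iz_j = 0` for all `i, j` (the quadratic characters
survive), then `{w, x, y, z}` splits into two equal pairs.  Printed proof: substitute
`z = w + x + y`; if `w, x, y` were pairwise distinct, pick `i` with `w_i ≠ x_i` and then a second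
index `j` where `y` differs from `w` (if `y_i = w_i`) or from `x` (if `y_i = x_i`); the `(i,j)`
constraint fails. [cite: BremnerMontanaroShepherd2016, App. Lemma 11 (proof)] -/
theorem pairing_of_constraints {w x y z : V → ZMod 2} (hL : w + x + y + z = 0)
    (hQ : ∀ i j, w i * w j + x i * x j + y i * y j + z i * z j = 0) : Pairing w x y z := by
  -- `z = w + x + y`
  have hz : ∀ i, z i = w i + x i + y i := by
    intro i
    have := congr_fun hL i
    simp only [Pi.add_apply, Pi.zero_apply] at this
    generalize w i = a, x i = b, y i = c, z i = d at this ⊢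
    revert a b c d; decide
  by_contra hP
  simp only [Pairing, not_or, not_and_or] at hP
  obtain ⟨h1, h2, h3⟩ := hP
  -- the three "distinctness" facts
  have hwx : w ≠ x := by
    rcases h1 with h | h
    · exact h
    · intro hwx; apply h; funext i; rw [hz i, hwx]
      generalize x i = b, y i = c; revert b c; decide
  have hwy : w ≠ y := by
    rcases h2 with h | h
    · exact h
    · intro hwy; apply h; funext i; rw [hz i, hwy]
      generalize x i = b, y i = c; revert b c; decide
  have hxy : x ≠ y := by
    rcases h3 with h | h
    · intro hxy; apply h; funext i; rw [hz i, hxy]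
      generalize w i = a, y i = c; revert a c; decide
    · exact h
  obtain ⟨i, hi⟩ := Function.ne_iff.1 hwx
  rw [ne_comm, ne_iff_eq_add_one] at hi
  by_cases hyi : y i = w i
  · -- second index from `w ≠ y`
    obtain ⟨j, hj⟩ := Function.ne_iff.1 hwy
    have q := hQ i j
    rw [hz i, hz j, hyi, hi] at q
    apply hj
    generalize w i = a, w j = b, x j = c, y j = d at q ⊢
    revert a b c d; decide
  · have hyx : y i = x i := by
      rw [hi]
      generalize w i = a, y i = c at hyi ⊢
      revert a c; decide
    obtain ⟨j, hj⟩ := Function.ne_iff.1 hxy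
    have q := hQ i j
    rw [hz i, hz j, hyx, hi] at q
    apply hj
    generalize w i = a, w j = b, x j = c, y j = d at q ⊢
    revert a b c d; decide

omit [Fintype V] [DecidableEq V] in
/-- Conversely a pairing satisfies both constraint systems (so the surviving terms are EXACTLY
the pairings). [cite: BremnerMontanaroShepherd2016, App. Lemma 11 (proof)] -/
theorem constraints_of_pairing {w x y z : V → ZMod 2} (h : Pairing w x y z) :
    w + x + y + z = 0 ∧ ∀ i j, w i * w j + x i * x j + y i * y j + z i * z j = 0 := by
  have hp : ∀ i j, (w i = x i ∧ y i = z i ∧ w j = x j ∧ y j = z j) ∨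
      (w i = y i ∧ x i = z i ∧ w j = y j ∧ x j = z j) ∨
      (w i = z i ∧ x i = y i ∧ w j = z j ∧ x j = y j) := by
    intro i j
    rcases h with ⟨h1, h2⟩ | ⟨h1, h2⟩ | ⟨h1, h2⟩
    · exact Or.inl ⟨congr_fun h1 i, congr_fun h2 i, congr_fun h1 j, congr_fun h2 j⟩
    · exact Or.inr (Or.inl ⟨congr_fun h1 i, congr_fun h2 i, congr_fun h1 j, congr_fun h2 j⟩)
    · exact Or.inr (Or.inr ⟨congr_fun h1 i, congr_fun h2 i, congr_fun h1 j, congr_fun h2 j⟩)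
  refine ⟨?_, fun i j => ?_⟩
  · funext i
    simp only [Pi.add_apply, Pi.zero_apply]
    have := hp i i
    generalize w i = a, x i = b, y i = c, z i = d at this ⊢
    revert a b c d; decide
  · have := hp i j
    generalize w i = a, x i = b, y i = c, z i = d, w j = a', x j = b', y j = c', z j = d' at this ⊢
    revert a b c d a' b' c' d'; decide

/-- The number of pairings among 4-tuples `((w,x),(y,z))`.
[cite: BremnerMontanaroShepherd2016, App. Lemma 11 (“at most 3 · 2^{2n}”)] -/
def pairingCount (V : Type*) [Fintype V] [DecidableEq V] : ℕ :=
  ((univ : Finset (((V → ZMod 2) × (V → ZMod 2)) × ((V → ZMod 2) × (V → ZMod 2)))).filter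
    fun p => Pairing p.1.1 p.1.2 p.2.1 p.2.2).card

/-- **`#pairings ≤ 3 · (2ⁿ)²`** (union bound over the three pairings, each determined by two free
strings). [cite: BremnerMontanaroShepherd2016, App. Lemma 11 (“The number of ways of choosing strings w, x, y, z to comply with this constraint is at most 3 · 2^{2n}”)] -/
theorem pairingCount_le : pairingCount V ≤ 3 * (2 ^ Fintype.card V) ^ 2 := by
  classical
  unfold pairingCount
  -- the three injections `(u, v) ↦ 4-tuple`
  let e1 : (V → ZMod 2) × (V → ZMod 2) →
      ((V → ZMod 2) × (V → ZMod 2)) × ((V → ZMod 2) × (V → ZMod 2)) :=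
    fun q => ((q.1, q.1), (q.2, q.2))
  let e2 : (V → ZMod 2) × (V → ZMod 2) →
      ((V → ZMod 2) × (V → ZMod 2)) × ((V → ZMod 2) × (V → ZMod 2)) :=
    fun q => ((q.1, q.2), (q.1, q.2))
  let e3 : (V → ZMod 2) × (V → ZMod 2) →
      ((V → ZMod 2) × (V → ZMod 2)) × ((V → ZMod 2) × (V → ZMod 2)) :=
    fun q => ((q.1, q.2), (q.2, q.1))
  have hsub : (univ.filter fun p : ((V → ZMod 2) × (V → ZMod 2)) × ((V → ZMod 2) × (V → ZMod 2)) =>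
      Pairing p.1.1 p.1.2 p.2.1 p.2.2) ⊆ univ.image e1 ∪ univ.image e2 ∪ univ.image e3 := by
    intro p hp
    rw [mem_filter] at hp
    obtain ⟨⟨w, x⟩, ⟨y, z⟩⟩ := p
    rcases hp.2 with ⟨h1, h2⟩ | ⟨h1, h2⟩ | ⟨h1, h2⟩ <;> simp only at h1 h2 <;> subst h1 <;> subst h2
    · exact mem_union_left _ (mem_union_left _ (mem_image.2 ⟨(w, y), mem_univ _, rfl⟩))
    · exact mem_union_left _ (mem_union_right _ (mem_image.2 ⟨(w, x), mem_univ _, rfl⟩))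
    · exact mem_union_right _ (mem_image.2 ⟨(w, x), mem_univ _, rfl⟩)
  have hcard : ∀ e : (V → ZMod 2) × (V → ZMod 2) →
      ((V → ZMod 2) × (V → ZMod 2)) × ((V → ZMod 2) × (V → ZMod 2)),
      (univ.image e).card ≤ (2 ^ Fintype.card V) ^ 2 := by
    intro e
    calc (univ.image e).card ≤ (univ : Finset ((V → ZMod 2) × (V → ZMod 2))).card := card_image_le
      _ = (2 ^ Fintype.card V) ^ 2 := by rw [card_univ, Fintype.card_prod, card_strings, sq]
  calc _ ≤ (univ.image e1 ∪ univ.image e2 ∪ univ.image e3).card := card_le_card hsub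
    _ ≤ (univ.image e1 ∪ univ.image e2).card + (univ.image e3).card := card_union_le _ _
    _ ≤ (univ.image e1).card + (univ.image e2).card + (univ.image e3).card := by
        gcongr; exact card_union_le _ _
    _ ≤ (2 ^ Fintype.card V) ^ 2 + (2 ^ Fintype.card V) ^ 2 + (2 ^ Fintype.card V) ^ 2 := by
        gcongr <;> exact hcard _
    _ = 3 * (2 ^ Fintype.card V) ^ 2 := by ring

/-! ### The character sums over the random coefficients -/

/-- **Averaging over the linear coefficients**: `Σ_γ (−1)^{Σ_k γ_k L_k} = 2ⁿ [L = 0]`.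
[cite: BremnerMontanaroShepherd2016, App. Lemma 11 proof (“= ∏_k 𝔼_{β_k}[η^{β_k(w_k+x_k−y_k−z_k)}], which equals 0 unless z ≡ w + x − y”)] -/
theorem sum_chi_linear [NeZero (2 : K)] (L : V → ZMod 2) :
    ∑ γ : V → ZMod 2, (chi (∑ k, γ k * L k) : K) =
      if L = 0 then (2 : K) ^ Fintype.card V else 0 :=
  sum_chi_dotProduct L

/-- **Averaging over the quadratic coefficients**: `Σ_β (−1)^{Σ_{i,j} β_{ij} M_{ij}} = 2^{n²} [M = 0]`
(the same orthogonality on `𝔽₂^{V×V}`). [cite: BremnerMontanaroShepherd2016, App. Lemma 11 proof (“∏_{i<j} 𝔼_{α_{ij}}[ω^{α_{ij}(…)}]”, zero unless every exponent vanishes)] -/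
theorem sum_chi_quadratic [NeZero (2 : K)] (M : V → V → ZMod 2) :
    ∑ β : V → V → ZMod 2, (chi (∑ i, ∑ j, β i j * M i j) : K) =
      if M = 0 then (2 : K) ^ (Fintype.card V * Fintype.card V) else 0 := by
  classical
  -- uncurry to `V × V → ZMod 2`
  have hcurry : ∑ β : V → V → ZMod 2, (chi (∑ i, ∑ j, β i j * M i j) : K) =
      ∑ β' : V × V → ZMod 2, (chi (β' ⬝ᵥ Function.uncurry M) : K) := by
    refine Fintype.sum_equiv (Equiv.curry V V (ZMod 2)).symm _ _ fun β => ?_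
    congr 1
    rw [dotProduct, Fintype.sum_prod_type]
    rfl
  rw [hcurry, sum_chi_dotProduct]
  refine if_congr ?_ (by rw [Fintype.card_prod]) rfl
  constructor
  · intro h; funext i j; exact congr_fun h (i, j)
  · intro h; subst h; funext p; rfl

/-! ### Fourth moment: Lemma 11 (`r = s = 2`) and Lemma 12 -/

/-- The quadratic exponents `M_{ij} = w_iw_j + x_ix_j + y_iy_j + z_iz_j` of a 4-tuple.
[cite: BremnerMontanaroShepherd2016, App. Lemma 12 proof (“Σ_{i,j} β_{ij}(w_iw_j + x_ix_j + y_iy_j + z_iz_j)”)] -/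
def quadExp (w x y z : V → ZMod 2) : V → V → ZMod 2 :=
  fun i j => w i * w j + x i * x j + y i * y j + z i * z j

omit [DecidableEq V] in
/-- `f(w) + f(x) + f(y) + f(z)` splits into the fixed part, the quadratic character and the
linear character. [cite: BremnerMontanaroShepherd2016, App. Lemma 12 proof (the display before “So”)] -/
theorem poly_four_sum (h : (V → ZMod 2) → ZMod 2) (β : V → V → ZMod 2) (γ : V → ZMod 2)
    (w x y z : V → ZMod 2) :
    poly h β γ w + poly h β γ x + poly h β γ y + poly h β γ z =
      (h w + h x + h y + h z) + (∑ i, ∑ j, β i j * quadExp w x y z i j) +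
        ∑ k, γ k * (w + x + y + z) k := by
  simp only [poly, quadPart, quadExp, Pi.add_apply, mul_add, sum_add_distrib]
  ring

omit [Fintype V] [DecidableEq V] in
/-- A fourth power of a finite sum as a sum over 4-tuples `((w,x),(y,z))`. [folklore] -/
private theorem sum_pow_four {ι : Type*} [Fintype ι] (a : ι → K) :
    (∑ x, a x) ^ 4 = ∑ p : (ι × ι) × (ι × ι), a p.1.1 * a p.1.2 * (a p.2.1 * a p.2.2) := by
  have h2 : (∑ x, a x) ^ 2 = ∑ q : ι × ι, a q.1 * a q.2 := by
    rw [sq, sum_mul_sum, ← Fintype.sum_prod_type']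
  rw [show (4 : ℕ) = 2 * 2 from rfl, pow_mul, h2, sq, sum_mul_sum, ← Fintype.sum_prod_type']

/-- The per-tuple value of the averaged character product: `2^{n²}·2ⁿ` on a pairing, `0` off it.
[cite: BremnerMontanaroShepherd2016, App. Lemma 11 (proof: “each term … evaluates to 0 unless …”)] -/
theorem sum_sum_chi_four [NeZero (2 : K)] (h : (V → ZMod 2) → ZMod 2) (w x y z : V → ZMod 2) :
    ∑ β : V → V → ZMod 2, ∑ γ : V → ZMod 2,
        (chi (poly h β γ w + poly h β γ x + poly h β γ y + poly h β γ z) : K) =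
      if Pairing w x y z then (2 : K) ^ (Fintype.card V * Fintype.card V) * (2 : K) ^ Fintype.card V
      else 0 := by
  classical
  simp_rw [poly_four_sum]
  -- factor the three characters
  have hfac : ∑ β : V → V → ZMod 2, ∑ γ : V → ZMod 2,
      (chi ((h w + h x + h y + h z) + (∑ i, ∑ j, β i j * quadExp w x y z i j) +
        ∑ k, γ k * (w + x + y + z) k) : K) =
      (chi (h w + h x + h y + h z) : K) *
        ((∑ β : V → V → ZMod 2, (chi (∑ i, ∑ j, β i j * quadExp w x y z i j) : K)) *
          ∑ γ : V → ZMod 2, (chi (∑ k, γ k * (w + x + y + z) k) : K)) := by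
    symm
    rw [sum_mul_sum, mul_sum]
    refine sum_congr rfl fun β _ => ?_
    rw [mul_sum]
    refine sum_congr rfl fun γ _ => ?_
    generalize h w + h x + h y + h z = H
    rw [chi_add, chi_add]
    ring
  rw [hfac, sum_chi_quadratic, sum_chi_linear]
  by_cases hP : Pairing w x y z
  · obtain ⟨hL, hQ⟩ := constraints_of_pairing hP
    have hM : quadExp w x y z = 0 := by funext i j; exact hQ i j
    have hH : h w + h x + h y + h z = 0 := by
      have two : ∀ a : ZMod 2, a + a = 0 := by decide
      rcases hP with ⟨h1, h2⟩ | ⟨h1, h2⟩ | ⟨h1, h2⟩ <;> rw [h1, h2]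
      · rw [two, zero_add, two]
      · rw [show h y + h z + h y + h z = (h y + h y) + (h z + h z) by ring, two, two, add_zero]
      · rw [show h z + h y + h y + h z = (h z + h z) + (h y + h y) by ring, two, two, add_zero]
    rw [if_pos hP, if_pos hM, if_pos hL, hH, chi_zero, one_mul]
  · rw [if_neg hP]
    have : ¬ (quadExp w x y z = 0 ∧ w + x + y + z = 0) := by
      rintro ⟨hM, hL⟩
      exact hP (pairing_of_constraints hL fun i j => congr_fun (congr_fun hM i) j)
    rcases not_and_or.1 this with hM | hL
    · rw [if_neg hM]; ring
    · rw [if_neg hL]; ring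

/-- **Fourth moment, summed**: `Σ_{β,γ} gap(poly h β γ)⁴ = 2^{n²} · 2ⁿ · #pairings` for every fixed
`h`. [cite: BremnerMontanaroShepherd2016, App. Lemma 12 (proof)] -/
theorem sum_sum_signSum_poly_pow_four [NeZero (2 : K)] (h : (V → ZMod 2) → ZMod 2) :
    ∑ β : V → V → ZMod 2, ∑ γ : V → ZMod 2, (signSum (poly h β γ) : K) ^ 4 =
      (2 : K) ^ (Fintype.card V * Fintype.card V) * (2 : K) ^ Fintype.card V * pairingCount V := by
  classical
  unfold signSum
  calc ∑ β : V → V → ZMod 2, ∑ γ : V → ZMod 2, (∑ x : V → ZMod 2, (chi (poly h β γ x) : K)) ^ 4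
      = ∑ β : V → V → ZMod 2, ∑ γ : V → ZMod 2,
          ∑ p : ((V → ZMod 2) × (V → ZMod 2)) × ((V → ZMod 2) × (V → ZMod 2)),
            (chi (poly h β γ p.1.1 + poly h β γ p.1.2 + poly h β γ p.2.1 + poly h β γ p.2.2) : K) := by
        refine sum_congr rfl fun β _ => sum_congr rfl fun γ _ => ?_
        rw [sum_pow_four]
        refine sum_congr rfl fun p _ => ?_
        rw [chi_add, chi_add, chi_add]
        ring
    _ = ∑ β : V → V → ZMod 2,
          ∑ p : ((V → ZMod 2) × (V → ZMod 2)) × ((V → ZMod 2) × (V → ZMod 2)), ∑ γ : V → ZMod 2,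
            (chi (poly h β γ p.1.1 + poly h β γ p.1.2 + poly h β γ p.2.1 + poly h β γ p.2.2) : K) :=
        sum_congr rfl fun β _ => sum_comm
    _ = ∑ p : ((V → ZMod 2) × (V → ZMod 2)) × ((V → ZMod 2) × (V → ZMod 2)),
          ∑ β : V → V → ZMod 2, ∑ γ : V → ZMod 2,
            (chi (poly h β γ p.1.1 + poly h β γ p.1.2 + poly h β γ p.2.1 + poly h β γ p.2.2) : K) :=
        sum_comm
    _ = ∑ p : ((V → ZMod 2) × (V → ZMod 2)) × ((V → ZMod 2) × (V → ZMod 2)),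
          (if Pairing p.1.1 p.1.2 p.2.1 p.2.2 then
            (2 : K) ^ (Fintype.card V * Fintype.card V) * (2 : K) ^ Fintype.card V else 0) :=
        sum_congr rfl fun p _ => sum_sum_chi_four h p.1.1 p.1.2 p.2.1 p.2.2
    _ = (2 : K) ^ (Fintype.card V * Fintype.card V) * (2 : K) ^ Fintype.card V * pairingCount V := by
        rw [← sum_filter, sum_const, nsmul_eq_mul, mul_comm, pairingCount]

/-- **Lemma 11 (`r = s = 2`, as printed up to the indexing of the quadratic coins)**:
`Σ_{w,x,y,z} |𝔼_β[(−1)^{Σ_{i,j} β_{ij} M_{ij}}] · 𝔼_γ[(−1)^{Σ_k γ_k L_k}]| ≤ 3 · 2^{2n}`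
(`M = quadExp`, `L = w + x + y + z`; each expectation is `1` or `0`, the product is `1` exactly on
the pairings). [cite: BremnerMontanaroShepherd2016, App. Lemma 11] -/
theorem lemma11_two :
    ∑ p : ((V → ZMod 2) × (V → ZMod 2)) × ((V → ZMod 2) × (V → ZMod 2)),
      |((∑ β : V → V → ZMod 2,
          (chi (∑ i, ∑ j, β i j * quadExp p.1.1 p.1.2 p.2.1 p.2.2 i j) : ℝ)) /
            Fintype.card (V → V → ZMod 2)) *
        ((∑ γ : V → ZMod 2, (chi (∑ k, γ k * (p.1.1 + p.1.2 + p.2.1 + p.2.2) k) : ℝ)) /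
            Fintype.card (V → ZMod 2))| ≤ 3 * ((2 : ℝ) ^ Fintype.card V) ^ 2 := by
  classical
  have hβ : (Fintype.card (V → V → ZMod 2) : ℝ) = (2 : ℝ) ^ (Fintype.card V * Fintype.card V) := by
    rw [Fintype.card_fun, card_strings, ← pow_mul, mul_comm]; push_cast; ring
  have hγ : (Fintype.card (V → ZMod 2) : ℝ) = (2 : ℝ) ^ Fintype.card V := by
    rw [card_strings]; push_cast; ring
  have hterm : ∀ p : ((V → ZMod 2) × (V → ZMod 2)) × ((V → ZMod 2) × (V → ZMod 2)),
      |((∑ β : V → V → ZMod 2,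
          (chi (∑ i, ∑ j, β i j * quadExp p.1.1 p.1.2 p.2.1 p.2.2 i j) : ℝ)) /
            Fintype.card (V → V → ZMod 2)) *
        ((∑ γ : V → ZMod 2, (chi (∑ k, γ k * (p.1.1 + p.1.2 + p.2.1 + p.2.2) k) : ℝ)) /
            Fintype.card (V → ZMod 2))| =
      if Pairing p.1.1 p.1.2 p.2.1 p.2.2 then 1 else 0 := by
    intro p
    rw [sum_chi_quadratic, sum_chi_linear, hβ, hγ]
    by_cases hP : Pairing p.1.1 p.1.2 p.2.1 p.2.2
    · obtain ⟨hL, hQ⟩ := constraints_of_pairing hP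
      have hM : quadExp p.1.1 p.1.2 p.2.1 p.2.2 = 0 := by funext i j; exact hQ i j
      rw [if_pos hM, if_pos hL, if_pos hP, div_self (by positivity), div_self (by positivity)]
      norm_num
    · rw [if_neg hP]
      have : ¬ (quadExp p.1.1 p.1.2 p.2.1 p.2.2 = 0 ∧ p.1.1 + p.1.2 + p.2.1 + p.2.2 = 0) := by
        rintro ⟨hM, hL⟩
        exact hP (pairing_of_constraints hL fun i j => congr_fun (congr_fun hM i) j)
      rcases not_and_or.1 this with hM | hL
      · rw [if_neg hM]; simp
      · rw [if_neg hL]; simp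
  simp_rw [hterm]
  rw [sum_boole]
  have := pairingCount_le (V := V)
  unfold pairingCount at this
  exact_mod_cast this

/-- `|coefficient space| = 2^{n²}` as a field element (plumbing). [folklore] -/
private theorem card_quadCoeffs : (Fintype.card (V → V → ZMod 2) : K) =
    (2 : K) ^ (Fintype.card V * Fintype.card V) := by
  rw [Fintype.card_fun, card_strings, ← pow_mul, mul_comm]; push_cast; ring

/-- **Lemma 12**: for a polynomial whose degree-`≤ 2` part is uniformly random (any fixed `h`),
`𝔼_{β,γ}[ngap(f)⁴] ≤ 3 · 2^{−2n}`. [cite: BremnerMontanaroShepherd2016, App. Lemma 12] -/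
theorem avg_ngap_pow_four_le (h : (V → ZMod 2) → ZMod 2) :
    (∑ β : V → V → ZMod 2, ∑ γ : V → ZMod 2, (ngap (poly h β γ) : ℝ) ^ 4) /
        ((Fintype.card (V → V → ZMod 2) : ℝ) * Fintype.card (V → ZMod 2)) ≤
      3 / ((2 : ℝ) ^ Fintype.card V) ^ 2 := by
  have hN : (0 : ℝ) < (2 : ℝ) ^ Fintype.card V := by positivity
  have hS := sum_sum_signSum_poly_pow_four (K := ℝ) h
  have hsum : ∑ β : V → V → ZMod 2, ∑ γ : V → ZMod 2, (ngap (poly h β γ) : ℝ) ^ 4 =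
      (2 : ℝ) ^ (Fintype.card V * Fintype.card V) * (2 : ℝ) ^ Fintype.card V * pairingCount V /
        ((2 : ℝ) ^ Fintype.card V) ^ 4 := by
    unfold ngap
    simp_rw [div_pow, ← Finset.sum_div]
    rw [hS]
  have hP : (pairingCount V : ℝ) ≤ 3 * ((2 : ℝ) ^ Fintype.card V) ^ 2 := by
    exact_mod_cast pairingCount_le (V := V)
  rw [hsum, card_quadCoeffs, card_strings]
  push_cast
  rw [div_div, div_le_div_iff₀ (by positivity) (by positivity)]
  have hX : (0 : ℝ) ≤ (2 : ℝ) ^ (Fintype.card V * Fintype.card V) * (2 : ℝ) ^ Fintype.card V *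
      ((2 : ℝ) ^ Fintype.card V) ^ 2 := by positivity
  nlinarith [mul_le_mul_of_nonneg_left hP hX]

/-! ### First moment of the family and Theorem 6's anticoncentration bound -/

/-- `Σ_{β,γ} ngap(poly h β γ)² = 2^{n²}`, i.e. `𝔼_{β,γ}[ngap²] = 2^{−n}` exactly.
[cite: BremnerMontanaroShepherd2016, p. 5 (“𝔼_𝒞[|⟨0|𝒞|0⟩|²] = 2^{−n}”)] -/
theorem sum_sum_ngap_poly_sq (h : (V → ZMod 2) → ZMod 2) :
    ∑ β : V → V → ZMod 2, ∑ γ : V → ZMod 2, (ngap (poly h β γ) : ℝ) ^ 2 =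
      (2 : ℝ) ^ (Fintype.card V * Fintype.card V) := by
  have hN : (2 : ℝ) ^ Fintype.card V ≠ 0 := by positivity
  have hinner : ∀ β : V → V → ZMod 2, ∑ γ : V → ZMod 2, (ngap (poly h β γ) : ℝ) ^ 2 = 1 := by
    intro β
    unfold ngap
    simp_rw [div_pow, ← Finset.sum_div]
    have hfun : ∀ γ : V → ZMod 2, poly h β γ =
        fun x => (h x + ∑ i, ∑ j, β i j * (x i * x j)) + γ ⬝ᵥ x := by
      intro γ; funext x; exact poly_apply h β γ x
    simp_rw [hfun]
    rw [sum_signSum_addLinear_sq (K := ℝ) (fun x => h x + ∑ i, ∑ j, β i j * (x i * x j))]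
    field_simp
  simp_rw [hinner, sum_const, card_univ, nsmul_eq_mul, mul_one]
  exact_mod_cast card_quadCoeffs (K := ℝ) (V := V)

/-- **Theorem 6's anticoncentration sentence**: for `0 ≤ α < 1` and every fixed degree-`> 2` part
`h`, `Pr_{β,γ}[ngap(f)² ≥ α/2ⁿ] ≥ (1 − α)²/3` (probability = fraction of the `2^{n²}·2ⁿ`
coefficient choices). [cite: BremnerMontanaroShepherd2016, Theorem 6 (proof: “Pr_f[ngap(f)² ≥ α/2ⁿ] ≥ (1−α)²/3 for any 0 < α < 1”)] -/
theorem prob_ngap_sq_ge (h : (V → ZMod 2) → ZMod 2) {α : ℝ} (hα0 : 0 ≤ α) (hα : α < 1) :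
    (1 - α) ^ 2 / 3 ≤
      ((univ.filter fun ω : (V → V → ZMod 2) × (V → ZMod 2) =>
          α / (2 : ℝ) ^ Fintype.card V ≤ (ngap (poly h ω.1 ω.2) : ℝ) ^ 2).card : ℝ) /
        Fintype.card ((V → V → ZMod 2) × (V → ZMod 2)) := by
  classical
  set Ω := (V → V → ZMod 2) × (V → ZMod 2)
  let R : Ω → ℝ := fun ω => (ngap (poly h ω.1 ω.2) : ℝ) ^ 2
  have hR : ∀ ω, 0 ≤ R ω := fun ω => sq_nonneg _
  have hN : (0 : ℝ) < (2 : ℝ) ^ Fintype.card V := by positivity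
  have hcardΩ : (Fintype.card Ω : ℝ) =
      (2 : ℝ) ^ (Fintype.card V * Fintype.card V) * (2 : ℝ) ^ Fintype.card V := by
    rw [Fintype.card_prod]; push_cast; rw [card_quadCoeffs, card_strings]; push_cast; ring
  -- first moment: `𝔼R = 2^{−n}`
  have hsum : ∑ ω, R ω = (2 : ℝ) ^ (Fintype.card V * Fintype.card V) := by
    rw [Fintype.sum_prod_type]
    exact sum_sum_ngap_poly_sq h
  have hmean : (∑ ω, R ω) / Fintype.card Ω = 1 / (2 : ℝ) ^ Fintype.card V := by
    rw [hsum, hcardΩ]; field_simp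
  -- second moment: `𝔼R² ≤ 3·2^{−2n}`
  have hsecond : (∑ ω, R ω ^ 2) / Fintype.card Ω ≤ 3 / ((2 : ℝ) ^ Fintype.card V) ^ 2 := by
    have : ∑ ω, R ω ^ 2 = ∑ β : V → V → ZMod 2, ∑ γ : V → ZMod 2, (ngap (poly h β γ) : ℝ) ^ 4 := by
      rw [Fintype.sum_prod_type]
      refine sum_congr rfl fun β _ => sum_congr rfl fun γ _ => ?_
      ring
    rw [this, Fintype.card_prod, Nat.cast_mul]
    exact avg_ngap_pow_four_le h
  -- Paley–Zygmund
  have hPZ := paleyZygmund_avg R hR hα0 hα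
  rw [hmean] at hPZ
  -- the event is the printed one
  have hev : (univ.filter fun ω : Ω => α * (1 / (2 : ℝ) ^ Fintype.card V) ≤ R ω) =
      univ.filter fun ω : Ω => α / (2 : ℝ) ^ Fintype.card V ≤ (ngap (poly h ω.1 ω.2) : ℝ) ^ 2 := by
    congr 1; ext ω; rw [mul_one_div]
  rw [hev] at hPZ
  set P := ((univ.filter fun ω : Ω =>
      α / (2 : ℝ) ^ Fintype.card V ≤ (ngap (poly h ω.1 ω.2) : ℝ) ^ 2).card : ℝ) / Fintype.card Ω
  have hP0 : 0 ≤ P := by positivity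
  -- `(1−α)²/2^{2n} ≤ 𝔼R² · P ≤ (3/2^{2n}) · P`
  have h1 : (1 - α) ^ 2 * (1 / (2 : ℝ) ^ Fintype.card V) ^ 2 ≤ 3 / ((2 : ℝ) ^ Fintype.card V) ^ 2 * P :=
    hPZ.trans (mul_le_mul_of_nonneg_right hsecond hP0)
  rw [one_div, inv_pow] at h1
  rw [div_le_iff₀ (by norm_num : (0 : ℝ) < 3)]
  have h2 := mul_le_mul_of_nonneg_right h1 (le_of_lt (pow_pos hN 2))
  field_simp at h2
  linarith [h2]

/-- **`α = 1/2`**: `Pr_{β,γ}[ngap(f)² ≥ 2^{−n−1}] ≥ 1/12` for every fixed degree-`> 2` part.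
[cite: BremnerMontanaroShepherd2016, Theorem 6 (proof: “Fixing α = 1/2, we get Pr_f[ngap(f)² ≥ 2^{−n−1}] ≥ 1/12”)] -/
theorem twelfth_le_prob_ngap_sq_ge (h : (V → ZMod 2) → ZMod 2) :
    (1 : ℝ) / 12 ≤
      ((univ.filter fun ω : (V → V → ZMod 2) × (V → ZMod 2) =>
          1 / (2 : ℝ) ^ (Fintype.card V + 1) ≤ (ngap (poly h ω.1 ω.2) : ℝ) ^ 2).card : ℝ) /
        Fintype.card ((V → V → ZMod 2) × (V → ZMod 2)) := by
  have hmain := prob_ngap_sq_ge h (α := 1 / 2) (by norm_num) (by norm_num)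
  have hhalf : (1 / 2 : ℝ) / (2 : ℝ) ^ Fintype.card V = 1 / (2 : ℝ) ^ (Fintype.card V + 1) := by
    rw [pow_succ, div_div, mul_comm]
  simp_rw [hhalf] at hmain
  norm_num at hmain ⊢
  exact hmain

/-- **“A uniformly random degree-3 polynomial”**: with the cubic coefficients `α_{ijk}` ALSO drawn
uniformly (independently of `β, γ`), `Pr_{α,β,γ}[ngap(f)² ≥ 2^{−n−1}] ≥ 1/12` (average of the
fixed-`h` bound over `h = cubicPart α`). [cite: BremnerMontanaroShepherd2016, Theorem 6 (proof) with App. (“we simply pick each of these coefficients uniformly at random … for each possible choice of the α_{ijk} coefficients”)] -/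
theorem twelfth_le_prob_ngap_sq_ge_cubic :
    (1 : ℝ) / 12 ≤
      ((univ.filter fun ω : (V → V → V → ZMod 2) × ((V → V → ZMod 2) × (V → ZMod 2)) =>
          1 / (2 : ℝ) ^ (Fintype.card V + 1) ≤
            (ngap (poly (cubicPart ω.1) ω.2.1 ω.2.2) : ℝ) ^ 2).card : ℝ) /
        Fintype.card ((V → V → V → ZMod 2) × ((V → V → ZMod 2) × (V → ZMod 2))) := by
  classical
  set A := (V → V → V → ZMod 2)
  set Ω := (V → V → ZMod 2) × (V → ZMod 2)
  have hΩ : (0 : ℝ) < Fintype.card Ω := by exact_mod_cast Fintype.card_pos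
  have hA : (0 : ℝ) < Fintype.card A := by exact_mod_cast Fintype.card_pos
  -- fibrewise count
  have hcountN : (univ.filter fun ω : A × Ω =>
      1 / (2 : ℝ) ^ (Fintype.card V + 1) ≤ (ngap (poly (cubicPart ω.1) ω.2.1 ω.2.2) : ℝ) ^ 2).card
      = ∑ a : A, (univ.filter fun ω : Ω =>
          1 / (2 : ℝ) ^ (Fintype.card V + 1) ≤ (ngap (poly (cubicPart a) ω.1 ω.2) : ℝ) ^ 2).card := by
    rw [card_filter, Fintype.sum_prod_type]
    refine sum_congr rfl fun a _ => ?_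
    rw [card_filter]
  have hcount : ((univ.filter fun ω : A × Ω =>
      1 / (2 : ℝ) ^ (Fintype.card V + 1) ≤ (ngap (poly (cubicPart ω.1) ω.2.1 ω.2.2) : ℝ) ^ 2).card : ℝ)
      = ∑ a : A, ((univ.filter fun ω : Ω =>
          1 / (2 : ℝ) ^ (Fintype.card V + 1) ≤ (ngap (poly (cubicPart a) ω.1 ω.2) : ℝ) ^ 2).card : ℝ) := by
    rw [hcountN]; push_cast; rfl
  have hfib : ∀ a : A, (Fintype.card Ω : ℝ) / 12 ≤ ((univ.filter fun ω : Ω =>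
      1 / (2 : ℝ) ^ (Fintype.card V + 1) ≤ (ngap (poly (cubicPart a) ω.1 ω.2) : ℝ) ^ 2).card : ℝ) := by
    intro a
    have := twelfth_le_prob_ngap_sq_ge (V := V) (cubicPart a)
    rw [le_div_iff₀ hΩ] at this
    linarith
  rw [hcount, Fintype.card_prod, Nat.cast_mul, le_div_iff₀ (by positivity)]
  calc (1 : ℝ) / 12 * (Fintype.card A * Fintype.card Ω) = ∑ _a : A, (Fintype.card Ω : ℝ) / 12 := by
        rw [sum_const, card_univ, nsmul_eq_mul]; ring
    _ ≤ _ := sum_le_sum fun a _ => hfib a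

/-! ### Lemma 11 as printed: general roots of unity (v2)

“Lemma 11. Let ω = e^{2πi/r}, η = e^{2πi/s} for some integers r and s such that r, s ≥ 2, and if
s = 2 then r = 2. Fix integer n. For pairs of integers i < j between 1 and n, let α_{ij} be picked
uniformly at random from {0, …, r−1}. For k ∈ {1, …, n}, let β_k be picked uniformly at random
from {0, …, s−1}. Then
Σ_{w,x,y,z ∈ {0,1}ⁿ} |𝔼_α[ω^{Σ_{i<j} α_{ij}(w_iw_j + x_ix_j − y_iy_j − z_iz_j)}]
  𝔼_β[η^{Σ_k β_k(w_k + x_k − y_k − z_k)}]| ≤ 3 · 2^{2n}.”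
Printed proof: `𝔼_β[…] = ∏_k 𝔼_{β_k}[η^{β_k(w_k+x_k−y_k−z_k)}]`, zero unless
`z ≡ w + x − y (mod s)`, in which case also `z ≡ w + x − y (mod r)` (for `s ≥ 3` the congruence
is an equality of integers; for `s = 2`, `r = 2`); then `𝔼_α[…]` is a product over `i < j` that
vanishes unless `w_i(y_j − x_j) + x_i(y_j − w_j) + y_i(w_j + x_j) ≡ 2y_iy_j (mod r)` for all
`i < j`, and if `w, x, y` are pairwise distinct some pair violates this (the expression, symmetric
in `i, j`, takes the value `±1`).  Bits are `V → ZMod 2` read in `ℤ` through `val`; the index set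
is ordered (`LinearOrder V`) so that the coins are exactly the `α_{ij}`, `i < j`. -/

section GeneralRoots

variable [LinearOrder V]

/-- A bit read as an integer. [cite: BremnerMontanaroShepherd2016, App. Lemma 11 (“w, x, y, z ∈ {0,1}ⁿ”)] -/
def bit (x : V → ZMod 2) (k : V) : ℤ := ((x k).val : ℤ)

omit [Fintype V] [DecidableEq V] [LinearOrder V] in
/-- A bit is `0` or `1`. [folklore] -/
private theorem bit_zero_or_one (x : V → ZMod 2) (k : V) : bit x k = 0 ∨ bit x k = 1 := by
  unfold bit
  have := (x k).val_lt
  omega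

omit [Fintype V] [DecidableEq V] [LinearOrder V] in
/-- Two bit vectors agree iff their integer readings agree. [folklore] -/
private theorem eq_iff_bit_eq (x y : V → ZMod 2) : x = y ↔ ∀ k, bit x k = bit y k := by
  constructor
  · rintro rfl k; rfl
  · intro h; funext k
    have := h k
    unfold bit at this
    exact ZMod.val_injective _ (by exact_mod_cast this)

/-- The linear exponents `w_k + x_k − y_k − z_k`.
[cite: BremnerMontanaroShepherd2016, App. Lemma 11 (statement)] -/
def linExp (w x y z : V → ZMod 2) (k : V) : ℤ := bit w k + bit x k - bit y k - bit z k

/-- The quadratic exponents `w_iw_j + x_ix_j − y_iy_j − z_iz_j`.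
[cite: BremnerMontanaroShepherd2016, App. Lemma 11 (statement)] -/
def quadExpZ (w x y z : V → ZMod 2) (i j : V) : ℤ :=
  bit w i * bit w j + bit x i * bit x j - bit y i * bit y j - bit z i * bit z j

/-- The ordered index pairs `i < j`. [cite: BremnerMontanaroShepherd2016, App. Lemma 11 (“For pairs of integers i < j between 1 and n”)] -/
abbrev LtPair (V : Type*) [LinearOrder V] := {q : V × V // q.1 < q.2}

/-- **Character sum over one coin**: for a primitive `r`-th root `ω` and an integer `t`,
`Σ_{a=0}^{r−1} ω^{a t} = r` if `r ∣ t` and `0` otherwise (“using the identities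
𝔼_α[ω^{αt}] = 0 for any integer t ≢ 0 mod r”). [cite: BremnerMontanaroShepherd2016, App. Lemma 11 (proof)] -/
theorem sum_rootChar {r : ℕ} (hr : r ≠ 0) {ω : ℂ} (hω : IsPrimitiveRoot ω r) (t : ℤ) :
    ∑ a : Fin r, ω ^ ((a : ℤ) * t) = if (r : ℤ) ∣ t then (r : ℂ) else 0 := by
  have hω0 : ω ≠ 0 := hω.ne_zero hr
  have hpow : ∀ a : Fin r, ω ^ ((a : ℤ) * t) = (ω ^ t) ^ (a : ℕ) := by
    intro a
    rw [mul_comm, zpow_mul, zpow_natCast]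
  simp_rw [hpow]
  rw [Fin.sum_univ_eq_sum_range (fun i => (ω ^ t) ^ i) r]
  split_ifs with hdvd
  · rw [(hω.zpow_eq_one_iff_dvd t).2 hdvd]
    simp
  · have hne : ω ^ t ≠ 1 := fun h => hdvd ((hω.zpow_eq_one_iff_dvd t).1 h)
    rw [geom_sum_eq hne]
    have : (ω ^ t) ^ r = 1 := by
      rw [← zpow_natCast, ← zpow_mul, mul_comm, zpow_mul, zpow_natCast, hω.pow_eq_one, one_zpow]
    rw [this, sub_self, zero_div]

omit [Fintype V] [DecidableEq V] [LinearOrder V] in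
/-- `ω^{Σ_q f q} = ∏_q ω^{f q}` for integer exponents (`ω ≠ 0`). [folklore] -/
private theorem zpow_finset_sum {ω : ℂ} (hω0 : ω ≠ 0) {ι : Type*} (s : Finset ι) (f : ι → ℤ) :
    ω ^ (∑ q ∈ s, f q) = ∏ q ∈ s, ω ^ f q := by
  classical
  induction s using Finset.induction_on with
  | empty => simp
  | insert a s ha ih => rw [sum_insert ha, prod_insert ha, zpow_add₀ hω0, ih]

/-- **Independence of the coins**: averaging `ω^{Σ_q α_q t_q}` over all coin vectors
`α : ι → {0,…,r−1}` factorises into the one-coin character sums, hence equals `r^{|ι|}` if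
`r ∣ t_q` for every `q` and `0` otherwise (“𝔼_α[ω^{Σ α_{ij}(…)}] = ∏_{i<j} 𝔼_{α_{ij}}[ω^{α_{ij}(…)}]”).
[cite: BremnerMontanaroShepherd2016, App. Lemma 11 (proof)] -/
theorem sum_zpow_sum_eq {r : ℕ} (hr : r ≠ 0) {ω : ℂ} (hω : IsPrimitiveRoot ω r) {ι : Type*}
    [Fintype ι] [DecidableEq ι] (t : ι → ℤ) :
    ∑ α : ι → Fin r, ω ^ (∑ q, ((α q : ℕ) : ℤ) * t q) =
      if ∀ q, (r : ℤ) ∣ t q then ((r : ℂ) ^ Fintype.card ι) else 0 := by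
  have hω0 : ω ≠ 0 := hω.ne_zero hr
  calc ∑ α : ι → Fin r, ω ^ (∑ q, ((α q : ℕ) : ℤ) * t q)
      = ∑ α : ι → Fin r, ∏ q, ω ^ (((α q : ℕ) : ℤ) * t q) :=
        sum_congr rfl fun α _ => zpow_finset_sum hω0 _ _
    _ = ∏ q, ∑ a : Fin r, ω ^ (((a : ℕ) : ℤ) * t q) := by
        rw [prod_univ_sum, Fintype.piFinset_univ]
    _ = ∏ q, (if (r : ℤ) ∣ t q then (r : ℂ) else 0) :=
        prod_congr rfl fun q _ => sum_rootChar hr hω (t q)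
    _ = if ∀ q, (r : ℤ) ∣ t q then ((r : ℂ) ^ Fintype.card ι) else 0 := by
        split_ifs with hall
        · rw [prod_congr rfl fun q _ => if_pos (hall q), prod_const, card_univ]
        · simp only [not_forall] at hall
          obtain ⟨q, hq⟩ := hall
          exact prod_eq_zero (mem_univ q) (if_neg hq)

omit [Fintype V] [DecidableEq V] [LinearOrder V] in
/-- One coordinate of the linear constraint: for bits `a, b, c, d` and `s ≥ 2`,
`s ∣ a + b − c − d` forces `a + b − c − d = 0`, except when `s = 2` and `{a,b} = {1,1}`,
`{c,d} = {0,0}` or vice versa (“as w + x − y ∈ {−1,0,1,2}ⁿ, z ≡ w + x − y mod s implies that in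
fact z = w + x − y” for `s ≥ 3`). [cite: BremnerMontanaroShepherd2016, App. Lemma 11 (proof)] -/
private theorem lin_coord {s : ℕ} (hs : 2 ≤ s) {a b c d : ℤ} (ha : a = 0 ∨ a = 1)
    (hb : b = 0 ∨ b = 1) (hc : c = 0 ∨ c = 1) (hd : d = 0 ∨ d = 1)
    (h : (s : ℤ) ∣ a + b - c - d) :
    a + b - c - d = 0 ∨ (s = 2 ∧ (a + b - c - d = 2 ∨ a + b - c - d = -2)) := by
  by_cases h0 : a + b - c - d = 0
  · exact Or.inl h0
  · right
    have hle := Int.natAbs_le_of_dvd_ne_zero h h0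
    have : (s : ℤ).natAbs = s := Int.natAbs_natCast s
    rw [this] at hle
    omega

omit [Fintype V] [DecidableEq V] in
/-- **Lemma 11's case analysis, as printed (general `r, s`).**  If `s ∣ w_k + x_k − y_k − z_k`
for every `k` and `r ∣ w_iw_j + x_ix_j − y_iy_j − z_iz_j` for every `i < j` (`r, s ≥ 2`,
`s = 2 → r = 2`), then `(w,x,y,z)` is a pairing.  Printed route: `z ≡ w + x − y (mod r)`; with
`u = w + x − y`, `w_iw_j + x_ix_j − y_iy_j − u_iu_j = w_i(y_j−x_j) + x_i(y_j−w_j) + y_i(w_j+x_j) − 2y_iy_j`;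
if `w ≠ x` pick `i` with `w_i ≠ x_i`, then `j` where `y` differs from `w` (if `y_i = w_i`) or from
`x` (if `y_i = x_i`): the expression is `±1 ≢ 0 (mod r)`. [cite: BremnerMontanaroShepherd2016, App. Lemma 11 (proof)] -/
theorem pairing_of_root_constraints {r s : ℕ} (hr : 2 ≤ r) (hs : 2 ≤ s) (hrs : s = 2 → r = 2)
    {w x y z : V → ZMod 2} (hL : ∀ k, (s : ℤ) ∣ linExp w x y z k)
    (hQ : ∀ i j, i < j → (r : ℤ) ∣ quadExpZ w x y z i j) : Pairing w x y z := by
  -- the quadratic constraint for all `i ≠ j` (the exponent is symmetric in `i, j`)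
  have hQ' : ∀ i j, i ≠ j → (r : ℤ) ∣ quadExpZ w x y z i j := by
    intro i j hij
    rcases lt_or_gt_of_ne hij with h | h
    · exact hQ i j h
    · have := hQ j i h
      simpa [quadExpZ, mul_comm] using this
  -- the linear constraint also holds mod `r`: `z ≡ w + x − y (mod r)`
  have hLr : ∀ k, (r : ℤ) ∣ linExp w x y z k := by
    intro k
    rcases lin_coord hs (bit_zero_or_one w k) (bit_zero_or_one x k) (bit_zero_or_one y k)
        (bit_zero_or_one z k) (hL k) with h0 | ⟨hs2, _⟩
    · unfold linExp; rw [h0]; exact dvd_zero _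
    · rw [hrs hs2]; rw [hs2] at hL; exact_mod_cast hL k
  -- coordinatewise consequences of the linear constraint
  have hcoord : ∀ k, bit w k + bit x k - bit y k - bit z k = 0 ∨
      (s = 2 ∧ (bit w k + bit x k - bit y k - bit z k = 2 ∨
        bit w k + bit x k - bit y k - bit z k = -2)) := fun k =>
    lin_coord hs (bit_zero_or_one w k) (bit_zero_or_one x k) (bit_zero_or_one y k)
      (bit_zero_or_one z k) (hL k)
  by_contra hP
  simp only [Pairing, not_or, not_and_or] at hP
  obtain ⟨h1, h2, h3⟩ := hP
  -- `w = x → y = z`, `w = y → x = z`, `x = y → w = z`, coordinatewise from the linear constraint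
  have hwx : w ≠ x := by
    rcases h1 with h | h
    · exact h
    · intro hwx; apply h; rw [eq_iff_bit_eq]; intro k
      have hk := hcoord k
      have e : bit w k = bit x k := by rw [hwx]
      rcases bit_zero_or_one x k with hb | hb <;> rcases bit_zero_or_one y k with hc | hc <;>
        rcases bit_zero_or_one z k with hd | hd <;> omega
  have hwy : w ≠ y := by
    rcases h2 with h | h
    · exact h
    · intro hwy; apply h; rw [eq_iff_bit_eq]; intro k
      have hk := hcoord k
      have e : bit w k = bit y k := by rw [hwy]
      rcases bit_zero_or_one w k with ha | ha <;> rcases bit_zero_or_one x k with hb | hb <;>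
        rcases bit_zero_or_one z k with hd | hd <;> omega
  have hxy : x ≠ y := by
    rcases h3 with h | h
    · intro hxy; apply h; rw [eq_iff_bit_eq]; intro k
      have hk := hcoord k
      have e : bit x k = bit y k := by rw [hxy]
      rcases bit_zero_or_one w k with ha | ha <;> rcases bit_zero_or_one x k with hb | hb <;>
        rcases bit_zero_or_one z k with hd | hd <;> omega
    · exact h
  -- the substituted expression `E(i,j)` is divisible by `r` for `i ≠ j`
  have hE : ∀ i j, i ≠ j → (r : ℤ) ∣ bit w i * (bit y j - bit x j) + bit x i * (bit y j - bit w j) +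
      bit y i * (bit w j + bit x j) - 2 * (bit y i * bit y j) := by
    intro i j hij
    have hq := hQ' i j hij
    have hi := hLr i
    have hj := hLr j
    unfold quadExpZ at hq
    unfold linExp at hi hj
    -- `E = M − u_i L_j − L_i u_j + L_i L_j` with `u = w + x − y`, `L = u − z`
    have key : bit w i * (bit y j - bit x j) + bit x i * (bit y j - bit w j) +
        bit y i * (bit w j + bit x j) - 2 * (bit y i * bit y j) =
        (bit w i * bit w j + bit x i * bit x j - bit y i * bit y j - bit z i * bit z j)
        - (bit w i + bit x i - bit y i) * (bit w j + bit x j - bit y j - bit z j)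
        - (bit w i + bit x i - bit y i - bit z i) * (bit w j + bit x j - bit y j)
        + (bit w i + bit x i - bit y i - bit z i) * (bit w j + bit x j - bit y j - bit z j) := by
      ring
    rw [key]
    exact ((hq.sub (hj.mul_left _)).sub (hi.mul_right _)).add (hi.mul_right _)
  -- `r ∣ ±1` is impossible
  have hunit : ∀ e : ℤ, (e = 1 ∨ e = -1) → ¬ (r : ℤ) ∣ e := by
    rintro e (rfl | rfl) h
    · have := Int.natAbs_le_of_dvd_ne_zero h one_ne_zero
      simp at this; omega
    · have := Int.natAbs_le_of_dvd_ne_zero h (by norm_num)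
      simp at this; omega
  obtain ⟨i, hi⟩ := Function.ne_iff.1 hwx
  have hib : bit w i ≠ bit x i := fun h => hi (ZMod.val_injective _ (by
    unfold bit at h; exact_mod_cast h))
  -- case analysis on `(w_i, x_i, y_i)`; the second index comes from `w ≠ y` or `x ≠ y`
  by_cases hyw : bit y i = bit w i
  · -- `y_i = w_i ≠ x_i`: take `j` with `y_j ≠ w_j` if `y_i = 0`… handled uniformly by the values
    rcases bit_zero_or_one w i with ha | ha
    · -- `w_i = 0, x_i = 1, y_i = 0`: `E(i,j) = y_j − w_j`
      obtain ⟨j, hj⟩ := Function.ne_iff.1 hwy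
      have hjb : bit w j ≠ bit y j := fun h => hj (ZMod.val_injective _ (by
        unfold bit at h; exact_mod_cast h))
      have hij : i ≠ j := by rintro rfl; exact hjb hyw.symm
      apply hunit _ _ (hE i j hij)
      rcases bit_zero_or_one x i with hb | hb <;> rcases bit_zero_or_one w j with hc | hc <;>
        rcases bit_zero_or_one x j with hd | hd <;> rcases bit_zero_or_one y j with he | he <;>
        simp only [ha, hb, hc, hd, he, hyw] at hib hjb ⊢ <;> omega
    · -- `w_i = 1, x_i = 0, y_i = 1`: `E(i,j) = w_j − y_j`
      obtain ⟨j, hj⟩ := Function.ne_iff.1 hwy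
      have hjb : bit w j ≠ bit y j := fun h => hj (ZMod.val_injective _ (by
        unfold bit at h; exact_mod_cast h))
      have hij : i ≠ j := by rintro rfl; exact hjb hyw.symm
      apply hunit _ _ (hE i j hij)
      rcases bit_zero_or_one x i with hb | hb <;> rcases bit_zero_or_one w j with hc | hc <;>
        rcases bit_zero_or_one x j with hd | hd <;> rcases bit_zero_or_one y j with he | he <;>
        simp only [ha, hb, hc, hd, he, hyw] at hib hjb ⊢ <;> omega
  · -- `y_i ≠ w_i`, so `y_i = x_i`: take `j` with `y_j ≠ x_j`
    have hyx : bit y i = bit x i := by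
      rcases bit_zero_or_one w i with ha | ha <;> rcases bit_zero_or_one x i with hb | hb <;>
        rcases bit_zero_or_one y i with hc | hc <;> omega
    obtain ⟨j, hj⟩ := Function.ne_iff.1 hxy
    have hjb : bit x j ≠ bit y j := fun h => hj (ZMod.val_injective _ (by
      unfold bit at h; exact_mod_cast h))
    have hij : i ≠ j := by rintro rfl; exact hjb hyx.symm
    apply hunit _ _ (hE i j hij)
    rcases bit_zero_or_one w i with ha | ha <;> rcases bit_zero_or_one x i with hb | hb <;>
      rcases bit_zero_or_one w j with hc | hc <;> rcases bit_zero_or_one x j with hd | hd <;>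
      rcases bit_zero_or_one y j with he | he <;>
      simp only [ha, hb, hc, hd, he, hyx] at hib hjb hyw ⊢ <;> omega

/-- **Lemma 11 (as printed, for primitive roots `ω, η` of orders `r, s`).**  With
`𝔼_α = r^{−#{i<j}} Σ_α` over `α : {i<j} → {0,…,r−1}` and `𝔼_β = s^{−n} Σ_β` over
`β : V → {0,…,s−1}`:
`Σ_{w,x,y,z} ‖𝔼_α[ω^{Σ_{i<j} α_{ij} M_{ij}}] · 𝔼_β[η^{Σ_k β_k L_k}]‖ ≤ 3 · (2ⁿ)²`
(`M_{ij} = w_iw_j + x_ix_j − y_iy_j − z_iz_j`, `L_k = w_k + x_k − y_k − z_k`; each factor is an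
indicator, and the surviving 4-tuples are pairings). [cite: BremnerMontanaroShepherd2016, App. Lemma 11] -/
theorem lemma11 {r s : ℕ} (hr : 2 ≤ r) (hs : 2 ≤ s) (hrs : s = 2 → r = 2) {ω η : ℂ}
    (hω : IsPrimitiveRoot ω r) (hη : IsPrimitiveRoot η s) :
    ∑ p : ((V → ZMod 2) × (V → ZMod 2)) × ((V → ZMod 2) × (V → ZMod 2)),
      ‖((∑ α : LtPair V → Fin r,
            ω ^ (∑ q : LtPair V, ((α q : ℕ) : ℤ) * quadExpZ p.1.1 p.1.2 p.2.1 p.2.2 q.1.1 q.1.2)) /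
          (r : ℂ) ^ Fintype.card (LtPair V)) *
        ((∑ β : V → Fin s, η ^ (∑ k, ((β k : ℕ) : ℤ) * linExp p.1.1 p.1.2 p.2.1 p.2.2 k)) /
          (s : ℂ) ^ Fintype.card V)‖ ≤ 3 * ((2 : ℝ) ^ Fintype.card V) ^ 2 := by
  classical
  have hr0 : r ≠ 0 := by omega
  have hs0 : s ≠ 0 := by omega
  have hrC : ((r : ℂ) ^ Fintype.card (LtPair V)) ≠ 0 := pow_ne_zero _ (by exact_mod_cast hr0)
  have hsC : ((s : ℂ) ^ Fintype.card V) ≠ 0 := pow_ne_zero _ (by exact_mod_cast hs0)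
  -- each summand is the indicator of "both constraint systems hold", hence ≤ the pairing indicator
  have hterm : ∀ p : ((V → ZMod 2) × (V → ZMod 2)) × ((V → ZMod 2) × (V → ZMod 2)),
      ‖((∑ α : LtPair V → Fin r,
            ω ^ (∑ q : LtPair V, ((α q : ℕ) : ℤ) * quadExpZ p.1.1 p.1.2 p.2.1 p.2.2 q.1.1 q.1.2)) /
          (r : ℂ) ^ Fintype.card (LtPair V)) *
        ((∑ β : V → Fin s, η ^ (∑ k, ((β k : ℕ) : ℤ) * linExp p.1.1 p.1.2 p.2.1 p.2.2 k)) /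
          (s : ℂ) ^ Fintype.card V)‖ ≤ if Pairing p.1.1 p.1.2 p.2.1 p.2.2 then (1 : ℝ) else 0 := by
    intro p
    rw [sum_zpow_sum_eq hr0 hω, sum_zpow_sum_eq hs0 hη]
    by_cases hQ : ∀ q : LtPair V, (r : ℤ) ∣ quadExpZ p.1.1 p.1.2 p.2.1 p.2.2 q.1.1 q.1.2
    · by_cases hL : ∀ k, (s : ℤ) ∣ linExp p.1.1 p.1.2 p.2.1 p.2.2 k
      · have hP : Pairing p.1.1 p.1.2 p.2.1 p.2.2 :=
          pairing_of_root_constraints hr hs hrs hL fun i j hij => hQ ⟨(i, j), hij⟩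
        rw [if_pos hQ, if_pos hL, if_pos hP, div_self hrC, div_self hsC]
        simp
      · rw [if_neg hL]
        simp only [zero_div, mul_zero, norm_zero]
        split_ifs <;> norm_num
    · rw [if_neg hQ]
      simp only [zero_div, zero_mul, norm_zero]
      split_ifs <;> norm_num
  calc _ ≤ ∑ p : ((V → ZMod 2) × (V → ZMod 2)) × ((V → ZMod 2) × (V → ZMod 2)),
        (if Pairing p.1.1 p.1.2 p.2.1 p.2.2 then (1 : ℝ) else 0) := sum_le_sum fun p _ => hterm p
    _ = pairingCount V := by rw [sum_boole]; rfl
    _ ≤ 3 * ((2 : ℝ) ^ Fintype.card V) ^ 2 := by exact_mod_cast pairingCount_le (V := V)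

/-- **Lemma 11 with the printed roots** `ω = e^{2πi/r}`, `η = e^{2πi/s}`.
[cite: BremnerMontanaroShepherd2016, App. Lemma 11] -/
theorem lemma11_exp {r s : ℕ} (hr : 2 ≤ r) (hs : 2 ≤ s) (hrs : s = 2 → r = 2) :
    ∑ p : ((V → ZMod 2) × (V → ZMod 2)) × ((V → ZMod 2) × (V → ZMod 2)),
      ‖((∑ α : LtPair V → Fin r,
            Complex.exp (2 * Real.pi * Complex.I / r) ^
              (∑ q : LtPair V, ((α q : ℕ) : ℤ) * quadExpZ p.1.1 p.1.2 p.2.1 p.2.2 q.1.1 q.1.2)) /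
          (r : ℂ) ^ Fintype.card (LtPair V)) *
        ((∑ β : V → Fin s, Complex.exp (2 * Real.pi * Complex.I / s) ^
              (∑ k, ((β k : ℕ) : ℤ) * linExp p.1.1 p.1.2 p.2.1 p.2.2 k)) /
          (s : ℂ) ^ Fintype.card V)‖ ≤ 3 * ((2 : ℝ) ^ Fintype.card V) ^ 2 :=
  lemma11 hr hs hrs (Complex.isPrimitiveRoot_exp r (by omega))
    (Complex.isPrimitiveRoot_exp s (by omega))

end GeneralRoots

/-! ### The random Ising family `𝒞_I`: `𝔼_{w,v}[|Z_R|⁴] ≤ 3 · 2^{2n}` (v3)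

“Z(ω) = Σ_{z ∈ {±1}ⁿ} ω^{Σ_{i<j} w_{ij} z_iz_j + Σ_{k=1}^n v_k z_k} … the case where ω = e^{iπ/8} and
the weights are picked by choosing uniformly at random from the set {0,…,7}” (p. 3, eq. (1));
App.: “Z(ω) = ω^{Σ_{i<j} w_{ij} + Σ_k v_k} Σ_{x ∈ {0,1}ⁿ} ω^{4Σ_{i<j} w_{ij} x_ix_j + 2Σ_k v'_k x_k},
where v'_k = −v_k − Σ_{j≠k} w_{jk} … It follows immediately from Lemma 11 that
𝔼_{w,v'}[|Z(ω)|⁴] ≤ 3 · 2^{2n}.”  Here `ω` is any primitive 16-th root of unity (`e^{iπ/8}` is one);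
instead of re-indexing `v ↦ v'` we average over `v` directly: the `v`-average of
`ω^{−2Σ_k v_k L_k}` is the indicator of `8 ∣ L_k ∀k`, on which the `w`-dependent shift
`ω^{−2Σ_k c_k(w) L_k}` is `1`, and the `w`-average of `ω^{4Σ_{i<j} w_{ij} M_{ij}}` is the indicator
of `4 ∣ M_{ij} ∀ i<j` — Lemma 11 with `r = 4`, `s = 8`. -/

section IsingFamily

variable [LinearOrder V]

/-- Ising spins `z_k = 1 − 2x_k ∈ {±1}` of a bit vector. [cite: BremnerMontanaroShepherd2016, App. ‘Proofs of anticoncentration bounds’ (“Z(ω) = Σ_x ω^{Σ w_{ij}(1−2x_i)(1−2x_j) + Σ v_k(1−2x_k)}”)] -/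
def spin (x : V → ZMod 2) (k : V) : ℤ := 1 - 2 * bit x k

/-- The Ising exponent `Σ_{i<j} w_{ij} z_i z_j + Σ_k v_k z_k` for weights `w_{ij}, v_k ∈ {0,…,7}`.
[cite: BremnerMontanaroShepherd2016, p. 3 eq. (1)] -/
def isingExp (w : LtPair V → Fin 8) (v : V → Fin 8) (x : V → ZMod 2) : ℤ :=
  ∑ q : LtPair V, ((w q : ℕ) : ℤ) * (spin x q.1.1 * spin x q.1.2) +
    ∑ k, ((v k : ℕ) : ℤ) * spin x k

/-- The random-Ising partition function `Z(ω) = Σ_{z ∈ {±1}ⁿ} ω^{Σ_{i<j} w_{ij} z_iz_j + Σ_k v_k z_k}`.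
[cite: BremnerMontanaroShepherd2016, p. 3 eq. (1)] -/
def isingZ (ω : ℂ) (w : LtPair V → Fin 8) (v : V → Fin 8) : ℂ :=
  ∑ x : V → ZMod 2, ω ^ isingExp w v x

/-- The `x`-independent part `Σ_{i<j} w_{ij} + Σ_k v_k` of the exponent.
[cite: BremnerMontanaroShepherd2016, App. (“Z(ω) = ω^{Σ_{i<j} w_{ij} + Σ_k v_k} Σ_x …”)] -/
def isingConst (w : LtPair V → Fin 8) (v : V → Fin 8) : ℤ :=
  ∑ q : LtPair V, ((w q : ℕ) : ℤ) + ∑ k, ((v k : ℕ) : ℤ)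

/-- The quadratic part `Σ_{i<j} w_{ij} x_i x_j`. [cite: BremnerMontanaroShepherd2016, App. (“ω^{4Σ_{i<j} w_{ij} x_ix_j + …}”)] -/
def quadW (w : LtPair V → Fin 8) (x : V → ZMod 2) : ℤ :=
  ∑ q : LtPair V, ((w q : ℕ) : ℤ) * (bit x q.1.1 * bit x q.1.2)

/-- The shift `c_k(w) = Σ_{j ≠ k} w_{jk}` (sum of the weights of the pairs containing `k`).
[cite: BremnerMontanaroShepherd2016, App. (“v'_k = −v_k − Σ_{j≠k} w_{jk}”)] -/
def pairShift (w : LtPair V → Fin 8) (k : V) : ℤ :=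
  ∑ q : LtPair V, ((w q : ℕ) : ℤ) * ((if q.1.1 = k then 1 else 0) + (if q.1.2 = k then 1 else 0))

/-- `v'_k = −v_k − Σ_{j≠k} w_{jk}`. [cite: BremnerMontanaroShepherd2016, App. (display of v'_k)] -/
def vPrime (w : LtPair V → Fin 8) (v : V → Fin 8) (k : V) : ℤ := -((v k : ℕ) : ℤ) - pairShift w k

/-- The linear part `Σ_k v'_k x_k`. [cite: BremnerMontanaroShepherd2016, App. (“… + 2Σ_k v'_k x_k”)] -/
def linWV (w : LtPair V → Fin 8) (v : V → Fin 8) (x : V → ZMod 2) : ℤ :=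
  ∑ k, vPrime w v k * bit x k

/-- `Σ_{i<j} w_{ij}(x_i + x_j) = Σ_k c_k(w) x_k`. [cite: BremnerMontanaroShepherd2016, App. (rewriting of Z(ω))] -/
private theorem sum_pair_ends (w : LtPair V → Fin 8) (x : V → ZMod 2) :
    ∑ q : LtPair V, ((w q : ℕ) : ℤ) * (bit x q.1.1 + bit x q.1.2) = ∑ k, pairShift w k * bit x k := by
  classical
  unfold pairShift
  simp_rw [sum_mul]
  rw [sum_comm]
  refine sum_congr rfl fun q _ => ?_
  simp_rw [mul_add, add_mul, sum_add_distrib, mul_assoc, ← mul_sum]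
  congr 1
  · congr 1
    rw [show (∑ k, (if q.1.1 = k then (1 : ℤ) else 0) * bit x k) = bit x q.1.1 from by
      simp_rw [ite_mul, one_mul, zero_mul]; rw [sum_ite_eq univ q.1.1]; simp]
  · congr 1
    rw [show (∑ k, (if q.1.2 = k then (1 : ℤ) else 0) * bit x k) = bit x q.1.2 from by
      simp_rw [ite_mul, one_mul, zero_mul]; rw [sum_ite_eq univ q.1.2]; simp]

/-- **The rewriting of `Z(ω)`**: with `z = 1 − 2x`,
`Σ w_{ij}z_iz_j + Σ v_kz_k = (Σ w_{ij} + Σ v_k) + 4Σ w_{ij}x_ix_j + 2Σ v'_kx_k`.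
[cite: BremnerMontanaroShepherd2016, App. (the two-line display rewriting Z(ω))] -/
theorem isingExp_eq (w : LtPair V → Fin 8) (v : V → Fin 8) (x : V → ZMod 2) :
    isingExp w v x = isingConst w v + 4 * quadW w x + 2 * linWV w v x := by
  have h1 : ∑ q : LtPair V, ((w q : ℕ) : ℤ) * (spin x q.1.1 * spin x q.1.2) =
      ∑ q : LtPair V, ((w q : ℕ) : ℤ) - 2 * ∑ q : LtPair V, ((w q : ℕ) : ℤ) * (bit x q.1.1 + bit x q.1.2)
        + 4 * ∑ q : LtPair V, ((w q : ℕ) : ℤ) * (bit x q.1.1 * bit x q.1.2) := by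
    simp only [spin, mul_sum, ← sum_sub_distrib, ← sum_add_distrib]
    refine sum_congr rfl fun q _ => ?_
    ring
  have h2 : ∑ k, ((v k : ℕ) : ℤ) * spin x k = ∑ k, ((v k : ℕ) : ℤ) - 2 * ∑ k, ((v k : ℕ) : ℤ) * bit x k := by
    simp only [spin, mul_sum, ← sum_sub_distrib]
    refine sum_congr rfl fun k _ => ?_
    ring
  have h3 : linWV w v x = -(∑ k, ((v k : ℕ) : ℤ) * bit x k) - ∑ k, pairShift w k * bit x k := by
    simp only [linWV, vPrime, sub_mul, neg_mul, sum_sub_distrib, sum_neg_distrib]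
  rw [isingExp, h1, h2, isingConst, quadW, h3, ← sum_pair_ends]
  ring

/-- `‖ω‖ = 1` for a primitive 16-th root. [folklore] -/
private theorem norm_root_sixteen {ω : ℂ} (hω : IsPrimitiveRoot ω 16) : ‖ω‖ = 1 :=
  hω.norm'_eq_one (by norm_num)

/-- `|Z(ω)| = |Σ_x ω^{4Σ w_{ij}x_ix_j + 2Σ v'_kx_k}|` (“up to an easily computed phase”).
[cite: BremnerMontanaroShepherd2016, App. (“Up to an easily computed phase, we can write Z(ω) = …”)] -/
theorem norm_isingZ_eq {ω : ℂ} (hω : IsPrimitiveRoot ω 16) (w : LtPair V → Fin 8) (v : V → Fin 8) :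
    ‖isingZ ω w v‖ = ‖∑ x : V → ZMod 2, ω ^ (4 * quadW w x + 2 * linWV w v x)‖ := by
  have hω0 : ω ≠ 0 := hω.ne_zero (by norm_num)
  have h : isingZ ω w v = ω ^ isingConst w v * ∑ x : V → ZMod 2, ω ^ (4 * quadW w x + 2 * linWV w v x) := by
    rw [isingZ, mul_sum]
    refine sum_congr rfl fun x _ => ?_
    rw [isingExp_eq, add_assoc, zpow_add₀ hω0]
  rw [h, norm_mul, norm_zpow, norm_root_sixteen hω, one_zpow, one_mul]

omit [Fintype V] [DecidableEq V] [LinearOrder V] in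
/-- `|Σ a|⁴ = Σ_{w,x,y,z} a_w a_x ā_y ā_z` (as a complex number). [folklore] -/
private theorem norm_sum_pow_four {ι : Type*} [Fintype ι] (a : ι → ℂ) :
    ((‖∑ i, a i‖ : ℂ)) ^ 4 =
      ∑ p : (ι × ι) × (ι × ι), a p.1.1 * a p.1.2 * ((starRingEnd ℂ) (a p.2.1) * (starRingEnd ℂ) (a p.2.2)) := by
  have h2 : ((‖∑ i, a i‖ : ℂ)) ^ 2 = (∑ i, a i) * (starRingEnd ℂ) (∑ i, a i) :=
    (Complex.mul_conj' _).symm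
  rw [show (4 : ℕ) = 2 * 2 from rfl, pow_mul, h2, map_sum, sq, mul_mul_mul_comm, sum_mul_sum,
    sum_mul_sum, ← Fintype.sum_prod_type', ← Fintype.sum_prod_type', sum_mul_sum,
    ← Fintype.sum_prod_type']

/-- Conjugation inverts a unimodular power: `conj(ω^m) = ω^{−m}`. [folklore] -/
private theorem conj_zpow_root {ω : ℂ} (hω : IsPrimitiveRoot ω 16) (m : ℤ) :
    (starRingEnd ℂ) (ω ^ m) = ω ^ (-m) := by
  rw [map_zpow₀, ← Complex.inv_eq_conj (norm_root_sixteen hω), inv_zpow', ]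

/-- The combined exponent of a 4-tuple term:
`(m_w + m_x − m_y − m_z) = 4Σ_{i<j} w_{ij} M_{ij} − 2Σ_k c_k(w) L_k − 2Σ_k v_k L_k`, with
`M = quadExpZ`, `L = linExp`. [cite: BremnerMontanaroShepherd2016, App. (Lemma 12 / Lemma 11 bookkeeping applied to Z(ω))] -/
theorem ising_four_exponent (w : LtPair V → Fin 8) (v : V → Fin 8) (a b c d : V → ZMod 2) :
    (4 * quadW w a + 2 * linWV w v a) + (4 * quadW w b + 2 * linWV w v b)
      - (4 * quadW w c + 2 * linWV w v c) - (4 * quadW w d + 2 * linWV w v d) =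
    4 * (∑ q : LtPair V, ((w q : ℕ) : ℤ) * quadExpZ a b c d q.1.1 q.1.2)
      - 2 * (∑ k, pairShift w k * linExp a b c d k) - 2 * (∑ k, ((v k : ℕ) : ℤ) * linExp a b c d k) := by
  have hq : quadW w a + quadW w b - quadW w c - quadW w d =
      ∑ q : LtPair V, ((w q : ℕ) : ℤ) * quadExpZ a b c d q.1.1 q.1.2 := by
    simp only [quadW, quadExpZ, ← sum_add_distrib, ← sum_sub_distrib]
    exact sum_congr rfl fun q _ => by ring
  have hl : linWV w v a + linWV w v b - linWV w v c - linWV w v d =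
      -(∑ k, ((v k : ℕ) : ℤ) * linExp a b c d k) - ∑ k, pairShift w k * linExp a b c d k := by
    simp only [linWV, vPrime, linExp, ← sum_add_distrib, ← sum_sub_distrib, ← sum_neg_distrib]
    exact sum_congr rfl fun k _ => by ring
  calc (4 * quadW w a + 2 * linWV w v a) + (4 * quadW w b + 2 * linWV w v b)
        - (4 * quadW w c + 2 * linWV w v c) - (4 * quadW w d + 2 * linWV w v d)
      = 4 * (quadW w a + quadW w b - quadW w c - quadW w d) +
          2 * (linWV w v a + linWV w v b - linWV w v c - linWV w v d) := by ring
    _ = _ := by rw [hq, hl]; ring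

/-- **Character sum over one coin, with slack**: for a primitive `r`-th root `ζ`, `r ∣ m`, and an
integer `t`, `Σ_{a=0}^{m−1} ζ^{at} = m·[r ∣ t]` (the `w_{ij} ∈ {0,…,7}` coins seen by `i = ω⁴`:
“we could in fact have picked the w_{ij} weights uniformly from the set {0,…,3}”).
[cite: BremnerMontanaroShepherd2016, App. (last sentence of the Ising paragraph)] -/
theorem sum_rootChar_of_dvd {r m : ℕ} (hrm : r ∣ m) {ζ : ℂ} (hζ : IsPrimitiveRoot ζ r)
    (t : ℤ) : ∑ a : Fin m, ζ ^ ((a : ℤ) * t) = if (r : ℤ) ∣ t then (m : ℂ) else 0 := by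
  have hpow : ∀ a : Fin m, ζ ^ ((a : ℤ) * t) = (ζ ^ t) ^ (a : ℕ) := by
    intro a
    rw [mul_comm, zpow_mul, zpow_natCast]
  simp_rw [hpow]
  rw [Fin.sum_univ_eq_sum_range (fun i => (ζ ^ t) ^ i) m]
  split_ifs with hdvd
  · rw [(hζ.zpow_eq_one_iff_dvd t).2 hdvd]
    simp
  · have hne : ζ ^ t ≠ 1 := fun h => hdvd ((hζ.zpow_eq_one_iff_dvd t).1 h)
    rw [geom_sum_eq hne]
    obtain ⟨c, hc⟩ := hrm
    have : (ζ ^ t) ^ m = 1 := by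
      rw [← zpow_natCast, ← zpow_mul, mul_comm, zpow_mul, zpow_natCast, hc, pow_mul, hζ.pow_eq_one,
        one_pow, one_zpow]
    rw [this, sub_self, zero_div]

/-- Independence of the coins, with slack (`ζ` of order `r ∣ m`, coins uniform on `{0,…,m−1}`).
[cite: BremnerMontanaroShepherd2016, App. Lemma 11 (proof) and the Ising paragraph] -/
theorem sum_zpow_sum_eq_of_dvd {r m : ℕ} (hr : r ≠ 0) (hrm : r ∣ m) {ζ : ℂ}
    (hζ : IsPrimitiveRoot ζ r) {ι : Type*} [Fintype ι] [DecidableEq ι] (t : ι → ℤ) :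
    ∑ α : ι → Fin m, ζ ^ (∑ q, ((α q : ℕ) : ℤ) * t q) =
      if ∀ q, (r : ℤ) ∣ t q then ((m : ℂ) ^ Fintype.card ι) else 0 := by
  have hζ0 : ζ ≠ 0 := hζ.ne_zero hr
  calc ∑ α : ι → Fin m, ζ ^ (∑ q, ((α q : ℕ) : ℤ) * t q)
      = ∑ α : ι → Fin m, ∏ q, ζ ^ (((α q : ℕ) : ℤ) * t q) :=
        sum_congr rfl fun α _ => zpow_finset_sum hζ0 _ _
    _ = ∏ q, ∑ a : Fin m, ζ ^ (((a : ℕ) : ℤ) * t q) := by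
        rw [prod_univ_sum, Fintype.piFinset_univ]
    _ = ∏ q, (if (r : ℤ) ∣ t q then (m : ℂ) else 0) :=
        prod_congr rfl fun q _ => sum_rootChar_of_dvd hrm hζ (t q)
    _ = if ∀ q, (r : ℤ) ∣ t q then ((m : ℂ) ^ Fintype.card ι) else 0 := by
        split_ifs with hall
        · rw [prod_congr rfl fun q _ => if_pos (hall q), prod_const, card_univ]
        · simp only [not_forall] at hall
          obtain ⟨q, hq⟩ := hall
          exact prod_eq_zero (mem_univ q) (if_neg hq)

/-- Exponent bookkeeping for a 4-tuple `p = ((a,b),(c,d))`: the `w`-quadratic part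
`4Σ_{i<j} w_{ij} M_{ij}`. [folklore] -/
private def expA (w : LtPair V → Fin 8)
    (p : ((V → ZMod 2) × (V → ZMod 2)) × ((V → ZMod 2) × (V → ZMod 2))) : ℤ :=
  4 * ∑ q : LtPair V, ((w q : ℕ) : ℤ) * quadExpZ p.1.1 p.1.2 p.2.1 p.2.2 q.1.1 q.1.2

/-- … the `w`-dependent shift `2Σ_k c_k(w) L_k`. [folklore] -/
private def expC (w : LtPair V → Fin 8)
    (p : ((V → ZMod 2) × (V → ZMod 2)) × ((V → ZMod 2) × (V → ZMod 2))) : ℤ :=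
  2 * ∑ k, pairShift w k * linExp p.1.1 p.1.2 p.2.1 p.2.2 k

/-- … and the `v`-linear part `2Σ_k v_k L_k`. [folklore] -/
private def expV (v : V → Fin 8)
    (p : ((V → ZMod 2) × (V → ZMod 2)) × ((V → ZMod 2) × (V → ZMod 2))) : ℤ :=
  2 * ∑ k, ((v k : ℕ) : ℤ) * linExp p.1.1 p.1.2 p.2.1 p.2.2 k

/-- **`𝔼_{w,v}[|Z_R|⁴] ≤ 3 · 2^{2n}`** for the random Ising family: `ω` a primitive 16-th root of
unity (`e^{iπ/8}`), edge weights `w_{ij}` (`i < j`) and vertex weights `v_k` uniform on `{0,…,7}`.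
[cite: BremnerMontanaroShepherd2016, p. 5 (“𝔼_{w,v}[|Z_R|⁴] ≤ 3·2^{2n}”) and App. (“It follows immediately from Lemma 11 that 𝔼_{w,v'}[|Z(ω)|⁴] ≤ 3 · 2^{2n}”)] -/
theorem avg_norm_isingZ_pow_four_le {ω : ℂ} (hω : IsPrimitiveRoot ω 16) :
    (∑ w : LtPair V → Fin 8, ∑ v : V → Fin 8, ‖isingZ ω w v‖ ^ 4) /
        ((8 : ℝ) ^ Fintype.card (LtPair V) * (8 : ℝ) ^ Fintype.card V) ≤
      3 * ((2 : ℝ) ^ Fintype.card V) ^ 2 := by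
  classical
  have hω0 : ω ≠ 0 := hω.ne_zero (by norm_num)
  have h16 : ω ^ (16 : ℕ) = 1 := hω.pow_eq_one
  have hω4 : IsPrimitiveRoot (ω ^ 4) 4 := hω.pow (by norm_num) (by norm_num)
  have hω2 : IsPrimitiveRoot (ω ^ 2) 8 := hω.pow (by norm_num) (by norm_num)
  set T := (V → ZMod 2) with hT
  -- Step 1: `|Z|⁴` as a sum over 4-tuples of one power of `ω`
  have hexp : ∀ (w : LtPair V → Fin 8) (v : V → Fin 8),
      ((‖isingZ ω w v‖ : ℂ)) ^ 4 =
        ∑ p : (T × T) × (T × T), ω ^ (expA w p - expC w p - expV v p) := by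
    intro w v
    rw [norm_isingZ_eq hω, norm_sum_pow_four]
    refine sum_congr rfl fun p _ => ?_
    rw [conj_zpow_root hω, conj_zpow_root hω, ← zpow_add₀ hω0, ← zpow_add₀ hω0, ← zpow_add₀ hω0]
    congr 1
    rw [expA, expC, expV, ← ising_four_exponent]
    ring
  -- Step 2: the `v`-average is the indicator of `8 ∣ L_k ∀k`
  have hv : ∀ (w : LtPair V → Fin 8) (p : (T × T) × (T × T)),
      ∑ v : V → Fin 8, ω ^ (expA w p - expC w p - expV v p) =
        ω ^ (expA w p - expC w p) *
          (if ∀ k, (8 : ℤ) ∣ -linExp p.1.1 p.1.2 p.2.1 p.2.2 k then (8 : ℂ) ^ Fintype.card V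
            else 0) := by
    intro w p
    have hrw : ∀ v : V → Fin 8, ω ^ (expA w p - expC w p - expV v p) =
        ω ^ (expA w p - expC w p) *
          (ω ^ 2) ^ (∑ k, ((v k : ℕ) : ℤ) * (-linExp p.1.1 p.1.2 p.2.1 p.2.2 k)) := by
      intro v
      rw [← zpow_natCast ω 2, ← zpow_mul, sub_eq_add_neg (expA w p - expC w p) (expV v p),
        zpow_add₀ hω0]
      congr 1
      congr 1
      rw [expV]
      push_cast
      rw [mul_sum, mul_sum, ← sum_neg_distrib]
      exact sum_congr rfl fun k _ => by ring
    simp_rw [hrw]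
    rw [← mul_sum, sum_zpow_sum_eq_of_dvd (by norm_num) (dvd_refl 8) hω2]
    norm_num
  -- Step 3: on that indicator the shift is trivial and the `w`-average is the indicator of `4 ∣ M`
  have hw : ∀ p : (T × T) × (T × T), (∀ k, (8 : ℤ) ∣ -linExp p.1.1 p.1.2 p.2.1 p.2.2 k) →
      ∑ w : LtPair V → Fin 8, ω ^ (expA w p - expC w p) =
        if ∀ q : LtPair V, (4 : ℤ) ∣ quadExpZ p.1.1 p.1.2 p.2.1 p.2.2 q.1.1 q.1.2
          then (8 : ℂ) ^ Fintype.card (LtPair V) else 0 := by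
    intro p hL
    have hshift : ∀ w : LtPair V → Fin 8, ω ^ (-expC w p) = 1 := by
      intro w
      have h8 : (8 : ℤ) ∣ ∑ k, pairShift w k * linExp p.1.1 p.1.2 p.2.1 p.2.2 k :=
        dvd_sum fun k _ => by
          have := hL k
          rw [dvd_neg] at this
          exact this.mul_left _
      obtain ⟨c, hc⟩ := h8
      have : -expC w p = ((16 : ℕ) : ℤ) * (-c) := by rw [expC, hc]; push_cast; ring
      rw [this, zpow_mul, zpow_natCast, h16, one_zpow]
    have hrw : ∀ w : LtPair V → Fin 8, ω ^ (expA w p - expC w p) =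
        (ω ^ 4) ^ (∑ q : LtPair V, ((w q : ℕ) : ℤ) * quadExpZ p.1.1 p.1.2 p.2.1 p.2.2 q.1.1 q.1.2) := by
      intro w
      rw [sub_eq_add_neg, zpow_add₀ hω0, hshift w, mul_one, ← zpow_natCast ω 4, ← zpow_mul]
      rfl
    simp_rw [hrw]
    rw [sum_zpow_sum_eq_of_dvd (by norm_num) (by norm_num : (4 : ℕ) ∣ 8) hω4]
    norm_num
  -- Step 4: the total is `8^{#pairs}·8ⁿ·#{p : both constraint systems hold}`
  set good : Finset ((T × T) × (T × T)) := univ.filter fun p =>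
      (∀ q : LtPair V, (4 : ℤ) ∣ quadExpZ p.1.1 p.1.2 p.2.1 p.2.2 q.1.1 q.1.2) ∧
        (∀ k, (8 : ℤ) ∣ -linExp p.1.1 p.1.2 p.2.1 p.2.2 k) with hgood
  have htotal : (((∑ w : LtPair V → Fin 8, ∑ v : V → Fin 8, ‖isingZ ω w v‖ ^ 4 : ℝ)) : ℂ) =
      (((8 : ℝ) ^ Fintype.card (LtPair V) * (8 : ℝ) ^ Fintype.card V * (good.card : ℝ) : ℝ) : ℂ) := by
    push_cast
    simp_rw [hexp]
    calc ∑ w : LtPair V → Fin 8, ∑ v : V → Fin 8, ∑ p : (T × T) × (T × T),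
            ω ^ (expA w p - expC w p - expV v p)
        = ∑ w : LtPair V → Fin 8, ∑ p : (T × T) × (T × T), ∑ v : V → Fin 8,
            ω ^ (expA w p - expC w p - expV v p) := sum_congr rfl fun w _ => sum_comm
      _ = ∑ p : (T × T) × (T × T), ∑ w : LtPair V → Fin 8, ∑ v : V → Fin 8,
            ω ^ (expA w p - expC w p - expV v p) := sum_comm
      _ = ∑ p : (T × T) × (T × T), (∑ w : LtPair V → Fin 8, ω ^ (expA w p - expC w p)) *
            (if ∀ k, (8 : ℤ) ∣ -linExp p.1.1 p.1.2 p.2.1 p.2.2 k then (8 : ℂ) ^ Fintype.card V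
              else 0) := by
          refine sum_congr rfl fun p _ => ?_
          rw [sum_mul]
          exact sum_congr rfl fun w _ => hv w p
      _ = ∑ p : (T × T) × (T × T), (if p ∈ good then
            (8 : ℂ) ^ Fintype.card (LtPair V) * (8 : ℂ) ^ Fintype.card V else 0) := by
          refine sum_congr rfl fun p _ => ?_
          have hmem : p ∈ good ↔ (∀ q : LtPair V, (4 : ℤ) ∣ quadExpZ p.1.1 p.1.2 p.2.1 p.2.2 q.1.1 q.1.2) ∧
              (∀ k, (8 : ℤ) ∣ -linExp p.1.1 p.1.2 p.2.1 p.2.2 k) := by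
            rw [hgood, mem_filter]; simp
          by_cases hL : ∀ k, (8 : ℤ) ∣ -linExp p.1.1 p.1.2 p.2.1 p.2.2 k
          · rw [if_pos hL, hw p hL]
            by_cases hQ : ∀ q : LtPair V, (4 : ℤ) ∣ quadExpZ p.1.1 p.1.2 p.2.1 p.2.2 q.1.1 q.1.2
            · rw [if_pos hQ, if_pos (hmem.2 ⟨hQ, hL⟩)]
            · rw [if_neg hQ, zero_mul, if_neg (fun h => hQ (hmem.1 h).1)]
          · rw [if_neg hL, mul_zero, if_neg (fun h => hL (hmem.1 h).2)]
      _ = (8 : ℂ) ^ Fintype.card (LtPair V) * (8 : ℂ) ^ Fintype.card V * (good.card : ℂ) := by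
          rw [← sum_filter, filter_mem_eq_inter, univ_inter, sum_const, nsmul_eq_mul]
          ring
  have hreal : (∑ w : LtPair V → Fin 8, ∑ v : V → Fin 8, ‖isingZ ω w v‖ ^ 4 : ℝ) =
      (8 : ℝ) ^ Fintype.card (LtPair V) * (8 : ℝ) ^ Fintype.card V * (good.card : ℝ) := by
    exact_mod_cast htotal
  -- Step 5: the surviving tuples are pairings (Lemma 11's case analysis with r = 4, s = 8)
  have hcard : good.card ≤ pairingCount V := by
    rw [pairingCount]
    refine card_le_card fun p hp => ?_
    rw [hgood, mem_filter] at hp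
    rw [mem_filter]
    refine ⟨mem_univ _, ?_⟩
    refine pairing_of_root_constraints (r := 4) (s := 8) (by norm_num) (by norm_num) (by norm_num)
      (fun k => ?_) (fun i j hij => ?_)
    · have := hp.2.2 k
      rw [dvd_neg] at this
      exact_mod_cast this
    · exact_mod_cast hp.2.1 ⟨(i, j), hij⟩
  have hpos : (0 : ℝ) < (8 : ℝ) ^ Fintype.card (LtPair V) * (8 : ℝ) ^ Fintype.card V := by positivity
  rw [hreal, mul_div_cancel_left₀ _ hpos.ne']
  calc (good.card : ℝ) ≤ pairingCount V := by exact_mod_cast hcard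
    _ ≤ 3 * ((2 : ℝ) ^ Fintype.card V) ^ 2 := by exact_mod_cast pairingCount_le (V := V)

/-- The printed root: `e^{iπ/8}` is a primitive 16-th root of unity, so the bound applies to it.
[cite: BremnerMontanaroShepherd2016, p. 3 (“restrict to the case where ω = e^{iπ/8}”)] -/
theorem avg_norm_isingZ_pow_four_le_exp :
    (∑ w : LtPair V → Fin 8, ∑ v : V → Fin 8,
        ‖isingZ (Complex.exp (Real.pi * Complex.I / 8)) w v‖ ^ 4) /
        ((8 : ℝ) ^ Fintype.card (LtPair V) * (8 : ℝ) ^ Fintype.card V) ≤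
      3 * ((2 : ℝ) ^ Fintype.card V) ^ 2 := by
  have h : Complex.exp (Real.pi * Complex.I / 8) = Complex.exp (2 * Real.pi * Complex.I / (16 : ℕ)) := by
    congr 1; push_cast; ring
  rw [h]
  exact avg_norm_isingZ_pow_four_le (Complex.isPrimitiveRoot_exp 16 (by norm_num))

end IsingFamily

section OutputDistribution

/-! ### The output distribution of `𝒞_f` (v4): every amplitude is a gap, Parseval -/

/-- **All output amplitudes are gaps of shifted polynomials**: `(W · 𝒞̃_f · W)(x, 0ⁿ) = gap(f_x)` with
`f_x(y) = f(y) + x·y` — the X gates / output string `x` only add a linear form to `f`: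
“p_{0y} = Pr[𝒞_0 outputs y] = |⟨y|𝒞_0|0⟩|² = |⟨0|𝒞_y|0⟩|²”.
[cite: BremnerMontanaroShepherd2016, p. 5 (display “p_{0y} = Pr[𝒞_0 outputs y] = |⟨y|𝒞_0|0⟩|² = |⟨0|𝒞_y|0⟩|²”) and App. ‘Gaps of degree-3 polynomials’] -/
theorem walshHadamard_phase_walshHadamard_apply_zero (f : (V → ZMod 2) → ZMod 2) (x : V → ZMod 2) :
    (walshHadamard * phaseDiag f * walshHadamard : Matrix (V → ZMod 2) (V → ZMod 2) K) x 0 =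
      signSum (fun y => f y + x ⬝ᵥ y) := by
  rw [mul_apply]
  unfold signSum
  refine sum_congr rfl fun y _ => ?_
  rw [phaseDiag, mul_diagonal]
  simp [walshHadamard, chi_add, mul_comm]

/-- The **output distribution** of the IQP circuit `𝒞_f = H^{⊗n} 𝒞̃_f H^{⊗n}` on input `|0ⁿ⟩`:
`p_f(x) = |⟨x|𝒞_f|0ⁿ⟩|² = ngap(f_x)²`, `f_x(y) = f(y) + x·y` (real amplitudes, so `|·|²` is a square).
[cite: BremnerMontanaroShepherd2016, p. 5 (“p_{0y} = Pr[𝒞_0 outputs y] = |⟨y|𝒞_0|0⟩|²”)] -/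
def outputProb (f : (V → ZMod 2) → ZMod 2) (x : V → ZMod 2) : K :=
  (ngap (fun y => f y + x ⬝ᵥ y)) ^ 2

/-- `p_f(x) = ((W 𝒞̃_f W)(x,0)/2ⁿ)²` — the definition agrees with the matrix element of
`H^{⊗n} 𝒞̃_f H^{⊗n} = 2^{−n} W 𝒞̃_f W`. [cite: BremnerMontanaroShepherd2016, p. 5 and App. ‘Gaps of degree-3 polynomials’] -/
theorem outputProb_eq_hdh_sq (f : (V → ZMod 2) → ZMod 2) (x : V → ZMod 2) :
    (outputProb f x : K) =
      ((walshHadamard * phaseDiag f * walshHadamard : Matrix (V → ZMod 2) (V → ZMod 2) K) x 0 /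
        (2 : K) ^ Fintype.card V) ^ 2 := by
  rw [walshHadamard_phase_walshHadamard_apply_zero, outputProb, ngap]

/-- **The output distribution is normalised** (Parseval): `Σ_x p_f(x) = 1`; equivalently the printed
first-moment computation “𝔼_𝒞[|⟨0|𝒞|0⟩|²] = (1/2ⁿ) 𝔼_𝒟 Σ_x |⟨x|𝒟|0⟩|² = 1/2ⁿ”.
[cite: BremnerMontanaroShepherd2016, p. 5 (display “= (1/2ⁿ) 𝔼_𝒟 Σ_{x∈{0,1}ⁿ} |⟨x|𝒟|0⟩|² = 1/2ⁿ”)] -/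
theorem sum_outputProb [NeZero (2 : K)] (f : (V → ZMod 2) → ZMod 2) :
    ∑ x : V → ZMod 2, (outputProb f x : K) = 1 := by
  have h2 : ((2 : K) ^ Fintype.card V) ≠ 0 := pow_ne_zero _ (NeZero.ne 2)
  simp only [outputProb, ngap, div_pow, ← sum_div]
  have h := sum_signSum_addLinear_sq (K := K) f
  have h' : ∑ x : V → ZMod 2, (signSum (fun y => f y + x ⬝ᵥ y) : K) ^ 2 =
      (2 : K) ^ Fintype.card V * (2 : K) ^ Fintype.card V := by
    rw [← h]
  rw [h', div_eq_one_iff_eq (pow_ne_zero _ h2)]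
  ring

/-- Hence the printed first moment: averaging over the output string, `𝔼_x[p_f(x)] = 2^{−n}` for
every `f`. [cite: BremnerMontanaroShepherd2016, p. 5] -/
theorem avg_outputProb [NeZero (2 : K)] (f : (V → ZMod 2) → ZMod 2) :
    (∑ x : V → ZMod 2, (outputProb f x : K)) / (2 : K) ^ Fintype.card V =
      1 / (2 : K) ^ Fintype.card V := by
  rw [sum_outputProb]

end OutputDistribution

end IQPAnticoncentration

end Literature.Computability.QuantumComplexity
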